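import Summits.HodgeConjecture.HodgeConjecture.Theses.PadicSemiregularLift
import Literature.AlgebraicGeometry.HodgeTheory.SemiregularityMap
import Literature.AlgebraicGeometry.HodgeTheory.SemiregularityObstructionBridge

/-!
# Disproof workfile — crux `PadicPridhamSemiregularity` (P1b, stmt-HodgeConjecture-13815)

Standing adversary (`cdisprove`, refuter-cdisprove-stmt-HodgeConjecture-13815-0, cycle 1; extended by
refuter-cdisprove-stmt-HodgeConjecture-13815-g2-0, cycle 2, §6–§9; extended by
refuter-cdisprove-stmt-HodgeConjecture-13815-g3-0, cycle 3, §10 = TARGETS: the registered skeletons' stubs;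
extended by refuter-cdisprove-stmt-HodgeConjecture-13815-g4-0, cycle 4, §11 = thickening-equivariance of
(β₁), the Dwork–Ogus witness, characteristic-zero transfer) on the INFORMAL crux P1b of route
`PadicSemiregularLift`:

* (i′)  `σ_q(o(E_n)) = gr^q Ob_n([E_n])` — the crystalline Buchweitz–Flenner map carries Illusie's
  obstruction to lifting the OBJECT `E_n ∈ VB(X_n)` to `X_{n+1}` onto the Bloch–Esnault–Kerz
  obstruction to lifting its CLASS `[E_n] ∈ K₀(X_n)`;
* (ii′) hence a p-ADICALLY SEMIREGULAR `E₁` (`⊕_{q<p} σ_q` injective on `Ext²(E₁,E₁)`) satisfies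
  (⋆) CLASS-LIFTS-IMPLY-OBJECT-LIFTS (= the hypothesis of the typed crux P1a
  `FormalLiftingFromClassLifting`): every finite locally free `F` on `X_{n+1}` with `F|X₁ ≅ E₁`
  whose `K₀`-class lifts to `X_{n+2}` lifts to `X_{n+2}`.

The crux has no Lean signature (the route file carries it as a comment), so no `¬`-refutation can
be typed; this file records the attacks as Lean over the tree's REAL carriers where they exist
(`KTheory.KZero`, `Scheme.Modules.pullback`, `HodgeTheory.AtiyahTraceAlgebra`) and as explicit
finite models otherwise. Prose only in docstrings.

## FINDINGS (cycle 1)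

1. **(ii′) is an elementary THEOREM — no kill is possible on the operative half of the crux, and
   (i′) is NOT needed for it** (§1). For `F ∈ VB(X_{n+1})` put
   `Σ_q(F) := σ_q(ob(F)) = tr(At(E₁)^q ∘ ob(F))/q! ∈ H^{q+2}(X₁, Ω^q)`. Then
   (A) `Σ_q` is ADDITIVE on short exact sequences `0 → S → F → Q → 0` of vector bundles on
   `X_{n+1}`: `Σ_q(F) = Σ_q(S) + Σ_q(Q)` (functoriality of `ob` and of `At` for `S ↪ F ↠ Q` makes
   both block upper triangular in frames adapted to `S`; the Yoneda/Čech product of block upper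
   triangular classes is block upper triangular with diagonal blocks the products of the diagonal
   blocks; the trace is the sum of the diagonal traces — toy: `trace_pow_mul_eq`); hence `Σ_q`
   factors through `K₀(X_{n+1})` (Fulton's `K⁰` of vector bundles = the tree's `KZero`);
   (B) `Σ_q([G|X_{n+1}]) = σ_q(ob(G|X_{n+1})) = σ_q(0) = 0` for every `G ∈ VB(X_{n+2})`, and these
   classes generate `im(K₀(X_{n+2}) → K₀(X_{n+1}))`;
   (C) so `[F] ∈ im ⇒ ⊕_q σ_q(ob F) = 0 ⇒ (semiregular) ob(F) = 0 ⇒ F` lifts.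
   Formal core: `StepObstructionTheory.lifts_of_classLifts` and the verbatim (⋆)-clause of P1a,
   `star_clause_of_stepTheories`, over `KZero`/`pullback`, with (A) and "`ob = 0 ↔` lifts"
   (Stacks 08VR) as the only hypotheses. No torsion-freeness, no `p > d + 6`, no projectivity,
   no K-theory of thickenings, no Bloch–Esnault–Kerz: only `q!` invertible for `q ≤ d − 2`.
   CONSEQUENCE FOR THE ROUTE: kill criterion (a) is vacuous in EVERY dimension (not only `d ≤ 2`
   as rattack-13815-0 and rattack-13815-g2 found); the conjectural content of "repaired P1" sits entirely in P1a
   (stmt-HodgeConjecture-13825: integral level-wise class lifting from a RATIONAL pro-class lift);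
   P1b should be demoted to a support item "`SemiregularClassLiftsImplyObjectLifts`" provable as
   soon as `ob`/`At`/`tr` have carriers (interface fields needed: `ob_eq_zero_iff` and (A)).
2. **(i′) is mis-typed at level `n ≥ 1`, `d ≥ 4`: the comparison map is NOT injective** (§2).
   By Bloch–Esnault–Kerz arXiv:1203.2776 Thm. 54 (= Kurihara's exponential isomorphism, read:
   p0021) `ker(𝒦^M_{q+1}(X_{n+2}) → 𝒦^M_{q+1}(X_{n+1})) ≅ Ω^q_{X₁}/B_nΩ^q_{X₁}` (`B₀ = 0`,
   `B_n` the iterated-Cartier boundaries), so the level-wise receptacle of the class obstruction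
   sees `σ_q(o)` only through `ῑ_n : H^{q+2}(X₁, Ω^q) → H^{q+2}(X₁, Ω^q/B_n)`, whose kernel is
   `im H^{q+2}(X₁, B_nΩ^q)`. LEAK LEMMA (proved in the docstring of `leak_model`): for
   `X₁ = E × B`, `E` a supersingular elliptic curve, `B` an ORDINARY abelian threefold
   (`𝒳 = Ẽ × 𝓑` an abelian scheme over `W`, Hodge-torsion-free, `d = 4`, `p ≥ 11` — inside the
   crux's hypotheses), `im(H³(X₁, B₁Ω¹) → H³(X₁, Ω¹)) = k · (1_E ⊗ F*η_B ⊗ ω_E) ≠ 0`. So refuter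
   g2's repair D2 ("`Ob ∈ im ι`, ι injective by Deligne–Illusie") is FALSE level-wise for `n ≥ 1`;
   no leak for `d ≤ 3` (any `n`), for `n = 0` (any `d`), for ordinary or superspecial `X₁`
   (proved ibid.). Since (ii′) no longer depends on (i′), this only concerns the decorative half.
3. **Natural strengthenings refuted / load-bearing hypotheses** (§3): semiregularity cannot be
   dropped from (C) beyond `ker σ ∋ ob(F)` (model `star_false_without_injectivity`); the class
   hypothesis cannot be dropped (rank one, Berthelot–Ogus: `not_lifts_without_classHypothesis`
   model); torsion-freeness is irrelevant to (ii′) (it is used nowhere in §1) — it belongs to P1a.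
5. **Calibration of the engine (β) beyond rank one** (§5): Bloch-semiregular graph curves
   `C_{φ,ψ} ≅ E ⊂ E³` satisfy LIFT ⟺ HODGE at first order for every lift `A₂` of `E³`
   (Grothendieck–Messing + `ℓ^⊥ = W₂ℓ` in rank-2 symplectic, `isotropic_with_line_iff`) — no kill;
   graph curves in `K3 × E`: LIFT fails with HODGE true exactly when `κ_t = 0`, and exactly then `C` is
   not semiregular with `ob(C) ∈ ker π_C` (`calibration_K3xE_recorded`) — no kill.
4. **Constraints on any future counterexample hunt for (i′)** (§4): Frobenius pull-backs have
   `At = 0`, hence `σ_{≥1} = 0` and "semiregular ⇔ tr injective ⇔ H²(End₀) = 0`"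
   (`isSemiregular_iff_trace_injective_of_atiyah_eq_zero`, over the tree's `AtiyahTraceAlgebra`);
   extensions of liftable bundles have `σ(ob) = 0` (special case of (A)).

## FINDINGS (cycle 2 — refuter-cdisprove-stmt-HodgeConjecture-13815-g2-0, 2026-08-16)

6. **Torsor test of the K₀-free engine P1b♮ — PASSED, no kill** (§6). Lift-change formula
   `o(F + e) = o(F) + β(e) + [n = 2]·(e ∘ e)` for two lifts `F`, `F + e` of the same bundle; and
   `σ(e ∘ e) = 0` in EVERY odd characteristic (Buchweitz–Flenner Prop. 3.12 + Cor. 4.8 — graded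
   centrality of `At`, cyclicity of `Tr`), CHECKED in Lean over the tree's `AtiyahTraceAlgebra` with
   centrality/cyclicity as the two named hypotheses (`semiregularityMap_sq_eq_zero`). So the
   lift-dependence of `σ(o(E_n))` is exactly a Bockstein image `σ(β(e))` — killed by `H_tf` in the
   normalised form of P1b♮ and by `p^n_*` in the unconditional form (§7), consistently at every level:
   the test refutes nothing and pins down where `H_tf` enters. By-products: a semiregular `E₁` has
   `x ∘ x = 0` on `Ext¹` (`sq_eq_zero_of_isSemiregular`, a free necessary condition for P2a's seeds);
   WARNING: the full "semiregular ⇒ unobstructed on fixed `X`" is FALSE in characteristic `p`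
   (non-reduced `Pic`: Igusa/Serre surfaces), first obstruction at order `≥ p`; the p-adic tower is
   guarded exactly by `H_tf`.
7. **The engine in its unconditional shape (β_n), audited step by step — no p-adic failure found**
   (§7): `π_{n+1}(ch_r^cris E₁) = p^n_* ι(± σ_{r-1}(o(E_n)))` in `H^{2r}(X_{n+1}, Ω^{<r})` for EVERY lift
   `E_n`, `p` odd, `r < p` (no `K₀`, no `H_tf`, no `p > d + 6`); the skeleton of its use with each
   hypothesis located (`liftsStep_of_padicBlochIdentity`; `H_tf` and Deligne–Illusie load-bearing:
   `not_liftsStep_without_pnInjective`, `not_liftsStep_without_iotaInjective`); the arithmetic heart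
   of transversality — ideator-1's stub `DividedPowerWindowCollapse` — PROVED in general
   (`dividedPowerWindowCollapse`) and shown to FAIL at `p = 2` (`dividedPowerWindow_fails_at_two`).
   RECOMMENDATION to the planner: restate P1b as (β_n); then neither P1a nor (⋆) is needed by the
   route, and `p > d` suffices.
8. **Strengthening S5 refuted** (§8): RATIONAL level-wise class lifting is vacuous
   (`coker(K₀(X_{n+2}) → K₀(X_{n+1}))` is p-primary torsion: Goodwillie ⊗ ℚ + Gabber rigidity), so
   "(⋆)_ℚ" is false by any non-liftable line bundle (`not_star_rational`, model); level-wise only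
   INTEGRAL class statements carry content (bearing on how P1a may use its rational pro-class).

9. **Scope** (§9): perfect complexes — no kill ((ii′) and (β_n) extend); twisted seeds — class side of
   (β_n) undefined (gap between P1b and P2a, route-level); proper suffices; `p` odd, `r < p`, `d < p`.
   MUTATION: the exact torsion hypothesis for the USE of (β_n) is (T_r) "`H^{2r}(𝒳, Ω^{<r}_{𝒳/W})`
   p-torsion-free, `1 ≤ r ≤ d`" (saturation + no Bockstein at once; `r = 1` = Berthelot–Ogus's `H²(𝒳,𝒪)`).

## FINDINGS (cycle 3 — refuter-cdisprove-stmt-HodgeConjecture-13815-g3-0, 2026-08-16)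

10. **TARGETS — the five stubs of the two registered skeletons survive a junk-model audit** (§10):
    line A (`Lines/sigma-ob-kzero-additivity.lean`: G `TowerStep`, H `IllusieObstructionAdditive`,
    T `IsZeroOneSemiregularOfIso`) and line B (`Lines/crystalline-abel-jacobi.lean`: `stub_firstStep`,
    `stub_deepSteps`; `Lines/fourier-rotation.lean` registers no stub) are TRUE as typed:
    `Deformation.IsFirstOrderThickening` EXTENDS `IsClosedImmersion` (so no `ker = ⊥` junk such as
    `P¹ → pt` or `Spec(k × k) → Spec k`, which would otherwise sink (B) through `Y = ∅`); in every model
    of H's hypotheses (`conormal ≅ j_*𝒪_Y`, `j` any closed immersion) the genuine Illusie class, read on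
    `Y` through `Ext²_{Z₀}(F, F ⊗ j_*𝒪_Y) ≅ Ext²_Y(j^*F, j^*F)` (projection formula + `j_*` exact +
    `Lj^*F = j^*F`), satisfies (B) and (A) — the ∃ over `Ob` makes H weaker, never false;
    `IsSmoothProperModel` carries Mathlib's `SmoothOfRelativeDimension`, so the flatness that G's conormal
    identification NEEDS is available — and load-bearing (affine model:
    `conormalStep_injective_of_torsionFree` / `conormalStep_false_without_torsionFree`, `𝒳 = Spec k`
    kills it); T is empty for `E = E'` (`isZeroOneSemiregular_of_eq`) and is otherwise EXACTLY the
    naturality (T′) `SigmaObstructionNatural` of the real `σ₀ = Tr`, `σ₁ = Tr(At ∘ −)` under isomorphisms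
    (`isZeroOneSemiregularOfIso_of_natural`) — true by functoriality of the tree's `JetSections`
    (`(s, φ) ↦ (e s, e ∘ φ)`, `δ(a, e s) = e δ(a, s)`) and conjugation invariance of `trace`, unproved in
    the tree.
11. **REDUCTION THEOREM — line B's ∃-stubs are line A in costume** (§10.2, kernel-checked over the
    real carriers): `HasStepDatum 𝒳 E₁ hE₁ n` (VERBATIM copy of line B's one-step output, the common
    body of `stub_firstStep` / `stub_deepSteps`) follows from an obstruction map `Ob` at the step with
    (B), (A₀), (A₁) (= line A's H at the step `X_{n+1} ⊂ X_{n+2}`, given G), (T′), and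
    `KernelVanishing` ("`Σᵢ` kills `ker(K₀(X_{n+1}) → K₀(X₁))`"): `hasStepDatum_of_additivePackage`,
    witness `δᵢ := Σᵢ` (Finding 1's generalised determinant on real `σᵢ`) descended to
    `im(K₀(X_{n+1}) → K₀(X₁))`, `ob := α_*Ob`, `εᵢ = 1`. At `n = 0`, `X_k ⟶ X₁` is an ISOMORPHISM for
    perfect `k` (`isIso_specialFibreToThickening_zero`, from `W(k)/p = k`:
    `wittQuotToResidue_zero_bijective`), so `KernelVanishing` is automatic and `stub_firstStep` needs
    NONE of `H_tf`, `IsProjectiveOverRing`, `p ≠ 2`, `d < p` (`hasStepDatum_zero_of_additivePackage`;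
    hypothesis mutation: all four are decoration there). CONSEQUENCE FOR LEAD AND PLANNER: the ∃-typed
    datum never mentions `ch^cris` — the crystalline Abel–Jacobi IDENTITY of line B lives in its
    docstrings only, and closing its stubs through §10.2 certifies nothing about (β_n)/(i′). To make the
    identity load-bearing, pin `δ` to the real crystalline Chern character (a
    `CrystallineRealization`-relative statement, named-fact pattern) or conclude what additivity cannot:
    step lifting WITHOUT the `K₀` hypothesis (line B's own `HasHodgeStepDatum` /
    `stepLifting_of_hodgeStepDatum`).
12. **Where `H_tf` really sits in line B** (§10.2): any datum forces lift-INVARIANCE of `σᵢ ∘ ob` over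
    ALL finite locally free lifts `(F, α)` of `E₁` to `X_{n+1}` (`exists_liftInvariant_of_hasStepDatum`).
    On the Godeaux–Serre model (`n = 1`, `E₁ = 𝒪`): `ob(𝒪_{X₂}) = 0 ≠ ob(M_a) = β(a)` and `σ₀ = Tr` is
    injective in rank one — so `stub_deepSteps` is FALSE without `H_tf` (it enters exactly through
    `KernelVanishing`, i.e. the torsor/Bockstein lemma of §6), whereas `stub_firstStep` survives its
    removal. Rank-one check of lift-invariance at EVERY level under `H_tf` (all of
    `ker(Pic X_{n+1} → Pic X₁) = H¹(1 + p𝒪_{X_{n+1}})` lifts to `X_{n+2}`: `p`-adic logarithm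
    `1 + p𝒪_{X_m} ≅ p𝒪_{X_m} ≅ 𝒪_{X_{m-1}}` for `p` odd, then `H¹(𝒪_{X_{n+1}}) ↠ H¹(𝒪_{X_n})`) — passed;
    higher rank is (β_n) itself.

## FINDINGS (cycle 4 — refuter-cdisprove-stmt-HodgeConjecture-13815-g4-0, 2026-08-16)

13. **(β₁) is EQUIVARIANT under the torsor of `W₂`-lifts, which proves it for every bundle liftable to
    SOME `W₂`-model of `X₁`, fixes its sign, and reduces the general case to naturality under maps — no
    divided powers at all at the first step** (§11.1). Under `X₂ ↦ X₂ + κ` (`κ ∈ H¹(X₁, T)`):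
    (T-ob) `o(E₁; X₂ + κ) = o(E₁; X₂) + κ ⌟ At(E₁)` (Illusie: `o = e(X₂) · At_{X₁/W}(E₁)`, the `W₂`-lifts
    being the splittings `L_{X₁/W} ≃ Ω¹ ⊕ 𝒪[1]`); (T-Hodge) `q_{X₂+κ}(c) = q_{X₂}(c) − ι(κ ⌟ c̄^{(r,r)})`
    for `c ∈ H^{2r}_cris(X₁/W₂)` with `c̄ ∈ F^r` (`F^r_{X₂+κ} = (1 + pθ_κ)F^r_{X₂}`, crystalline
    Kodaira–Spencer; `q_{X₂}` := the level-2 Hodge defect divided by `p`, receptacle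
    `H̄/F̄^r = H^{2r}(X₁, Ω^{<r})`, in which `ι : F̄^{r-1}/F̄^r ↪ H̄/F̄^r` is injective TAUTOLOGICALLY and
    `p_*` is injective as soon as `H^{2r}_cris(X₁/W₂)` is free with `F^r_{X₂}` a direct summand); and
    `ι σ_{r-1}(κ ⌟ At) = ι(κ ⌟ ch_r^{(r,r)})` (Buchweitz–Flenner: `ι_κ` is a derivation, the trace is
    cyclic). Hence (`padicBloch_shift_iff`) the identity with `ε = −1` holds at `X₂` iff at `X₂ + κ`; the
    defect `Δ_r(E₁) := q_{X₂}(ch_r^cris E₁) + ι σ_{r-1}(o(E₁; X₂))` is INDEPENDENT of the lift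
    (`padicBloch_defect_shift_invariant`); the opposite sign is refuted by the torsor structure
    (`padicBloch_plus_sign_refuted` — this settles the "universal sign `ε_r`" left open in §7); and if `E₁`
    lifts to `X₂ + κ` then `o + κ⌟At = 0` and `q_{X₂+κ}(ch_r^cris E₁) = 0` (Berthelot–Illusie: the
    crystalline Chern character of a liftable bundle is the de Rham one of the lift, in `F^r`), so (β₁)
    HOLDS at `X₂` (`padicBloch_of_liftsSomewhere`). By Finding 1 (A), `Δ_r : K₀(X₁) → H^{2r}(X₁, Ω^{<r})`
    is a homomorphism killing `K₀^{lift}(X₁)` = ⟨classes liftable to some `W₂`-model⟩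
    (`defect_eq_of_sub_mem`); with the MAP versions of (T-ob)/(T-Hodge) (`f : X₁ → Y₁`, map obstruction
    `θ_f ∈ H¹(f^*T_Y)`) `Δ_r` is natural under all pull-backs, `Δ(E ⊗ L) = Δ(E)·e^{c̄₁(L)}` (Leibniz on both
    sides, rank one = Berthelot–Ogus), and `Δ` dies on `Grass_W` — so (β₁) holds in general on smooth
    PROJECTIVE `X₁`, the cards' classifying-map argument with `p² = 0` making every Taylor series linear.
    VERDICT: the first step of the engine is as solid as its two textbook transformation rules; this seat
    has no first-step attack left.
14. **THE DWORK–OGUS WITNESS — strengthening S6 "Hodge at ALL levels (integrally) + `H_tf` + smooth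
    projective + `d + 6 < p` ⇒ `E₁` lifts to `X₂`" is FALSE, with a printed witness inside the route's own
    anchor class** (§11.2). B. Dwork – A. Ogus, *Canonical liftings of Jacobians*, Compositio Math. 58
    (1986) 111–131 (read from numdam): Thm. (1.9) p. 117 — for `g ≥ 4`, `p` odd, pre-`W₂`-canonical
    ordinary curves are nowhere dense in `M_g^{ord}`, i.e. a generic ordinary `C` does NOT lift into
    `J(C)^can ⊗ W₂`; (1.1.3)/(1.4.3) p. 113–115 — `H¹_cris(A/W) = U ⊕ T`, `F¹H¹_dR(A^can/W) = T`,
    `(A^can)^∨ = (A^∨)^can`, polarisations lift, `A^can` is algebraizable. WITNESS: `k = 𝔽̄_p`, `p ≥ 11`,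
    `C` generic ordinary of genus `4`, `𝒳 := Ĵ(C)^can` (abelian scheme, `d = 4`, Hodge-torsion-free,
    `Ω¹` free — inside the typed hypotheses of P1a too), `E₁ := E_D = Φ(𝒪_C(D))` the Picard bundle
    (`deg D ≥ 7`, finite locally free of rank `deg D − 3`; `Φ` = Fourier–Mukai with the Poincaré bundle).
    (a) EVERY `φ`-Tate class of `H^{2r}_cris(Ĵ/W) = Λ^{2r}(U ⊕ T)` lies in `Λ^rU ⊗ Λ^rT` integrally
    (slope bookkeeping: `φ = p^b·(σ-bijection)` on `Λ^{2r−b}U ⊗ Λ^bT`), which is `⊂ F^r H^{2r}_dR(𝒳/W)`;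
    crystalline Chern classes are `φ`-Tate on the nose (`c_i(Fr^*G) = p^i c_i(G)` by the splitting
    principle), so `ch^cris(E₁)` is Hodge at every level, integrally, saturated. (b) `E₁` does NOT lift to
    `X₂`: `Φ` is defined over `W₂` by `P^can` and commutes with restriction (derived base change, `q` flat),
    so a locally free lift of `E_D` gives a perfect, hence `W₂`-flat coherent, lift of `𝒪_C(D)`, i.e. an
    invertible sheaf on a flat lift `C₂ ⊂ J^can ⊗ W₂` of `C`, and then `(J^can_2, λ^can) ≅ (J(C₂), θ)`
    (Albanese + rigidity) — `C` would be pre-`W₂`-canonical. (c) `E₁` is NOT p-adically semiregular, for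
    the mechanism's own reason: Bloch-semiregularity of the Abel–Jacobi curve needs
    `h¹(N_{C/J}) = g² − 3g + 3 ≤ h^g(J, Ω^{g−2}) = g(g−1)/2`, i.e. `g ≤ 3`
    (`abelJacobi_semiregular_dimcount_iff`) — the semiregularity threshold IS the Dwork–Ogus threshold; and
    directly: `E₁` lifts to the `W₂`-model `Ĵ(𝒞₂)` for any lift `𝒞₂` of `C`, so (β₁) holds for
    `(X₂, E₁)` by Finding 13 and gives `σ_q(o(E₁; X₂)) = 0` for all `q` with `o ≠ 0`. (d) CONSEQUENCES:
    S6 is refuted (semiregularity cannot be dropped from "semiregular + Hodge + `H_tf` ⇒ lifts" even ON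
    the Hodge locus, even on ordinary abelian anchors' cousins — sharper than S1 of §3, which went OFF the
    Hodge locus); the object/class gap is REAL: by the P1a seat's paper theorems S1–S3
    (`Theorems/FormalLiftingFromClassLifting/Negative/ProClassCorrectionStubs.lean`) + BEK Thm 1.3, `[E₁]`
    lifts integrally and compatibly to every `K₀(X_n)` and algebraizes rationally (`θ`-polynomial), while
    `E₁` lifts to no level `≥ 2` — so (⋆) FAILS for this non-semiregular `E₁` (geometric instance of §3 S2);
    and for `g = 3` non-hyperelliptic the count is tight and the mechanism PREDICTS pre-`W_n`-canonicity
    for all `n`, which is TRUE (`Def(C) ≅ Def(J, λ)`, both 6-dimensional; Dwork–Ogus p. 117–118).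
    (e) DIRECT VERIFICATION OF (β₁) ON THE WITNESS — the would-be cheapest falsifier of the whole engine,
    RESOLVED, passes (§11.2): `σ_q(o(E_D; X₂)) = 0` for EVERY `q` although `o ≠ 0`, independently of
    Finding 13, by the Fourier–Mukai dictionary on `J`: `At(E_D)` = infinitesimal translations
    `κ_v`, `v ∈ T₀Ĵ = H¹(J,𝒪)`, which correspond to `α(v) = i_*(v|_C) ∈ F¹Ext¹_J(i_*F, i_*F)` (locally
    trivial: twists of the line bundle `F = 𝒪_C(D)` on the FIXED curve); `o(E_D)` corresponds to the
    embedded obstruction `ω ∈ F¹Ext² = H¹(C, N)` (locally `𝒪_C(D)` lifts); the unit classes `a · id`,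
    `a ∈ H¹(Ĵ,𝒪) = T₀J`, correspond to translations `τ_a ∈ F⁰Ext¹` (symbol `a|_C mod T_C ∈ H⁰(N)`); the
    local-to-global filtration (`Ext^n ⊃ F¹ = H¹(C, Λ^{n−1}N)`, `F² = 0` on a curve) is multiplicative.
    Hence `α(v)α(v') ∈ F²Ext² = 0`, i.e. `At(E_D)² = 0` — equivalently `ch(E_D) = rk − θ̂` EXACTLY
    (GRR: `ch(E_D) = q_*(e^{c₁(P)}·p^*([C] + (d+1−g)[pt]))`, and `σ^k = 0` on `C × Ĵ` for `k ≥ 3`;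
    Mattuck/Poincaré `c(E_D) = e^{−θ}`) — so `σ_q ≡ 0` on `Ext²(E_D,E_D)` for `q ≥ 2`;
    `σ₁(o)(v) ∪ a = tr₄(κ_v ∘ o ∘ (a·id)) ↔ α(v)·ω·τ_a ∈ F^{1+1+0}Ext⁴ = 0`, so `σ₁(o(E_D)) = 0`
    (`H³(𝒪) × H¹(𝒪) → H⁴(𝒪)` perfect, `tr` is `H^*(𝒪)`-linear); `σ₀(o) = o(det E_D) = 0` because EVERY
    line bundle on an ordinary abelian variety lifts to `A^can_2` (`o(L^p) = Fr_can^* o(L)` by the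
    Frobenius lift (1.4.2) and `o(L^p) = p·o(L) = 0`, with `Fr^*` bijective on `H²(𝒪) = Λ²H¹(𝒪)`).
    Both sides of (β₁) vanish: the engine passes its first `d = 4` test on an object with `o ≠ 0` and all
    classes Hodge; `E_D` is CERTIFIED non-semiregular with `0 ≠ o(E_D) ∈ ker ⊕σ_q`. The same dictionary
    shows that FM transforms of curve-supported sheaves never see beyond the determinant, and the transfer
    lemma of Finding 15 + char-0 Bloch–Pridham + the Torelli count show that NO Jacobian-derived object
    with `θ`-polynomial class (`W_d`, Picard bundles, `𝒪_C`) is p-adically semiregular for `g ≥ 4` at an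
    ordinary liftable `C` — the whole Dwork–Ogus family is disjoint from the mechanism's domain.
15. **Characteristic-zero transfer** (§11.3, `injective_of_injective_mod`): a p-adically semiregular `E₁`
    that lifts, jointly with `X₁`, to SOME `W`-model `(𝒳', ℰ)` has `ℰ_K` semiregular in characteristic `0`
    (injective mod `p` ⇒ injective, for `Ext²_W(ℰ,ℰ)` separated and `⊕H^{q+2}(Ω^q)` torsion-free; `H_tf`
    again load-bearing: `not_injective_of_injective_mod_without_torsionFree`). So Bloch–Buchweitz–Flenner–
    Pridham governs every liftable semiregular pair, counterexample hunts against the USE of (β_n) are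
    confined to pairs `(X₁, E₁)` liftable to no `W`-model jointly, and the route's lifted seeds are
    automatically char-0 semiregular sheaves on `X_K` (their classes have Hodge locus = deformation locus —
    information for P2a, not against P1b).
16. **Housekeeping**: `Negative/SpecialFibreIso.lean` (p76528, bounced by a gate restart) resubmitted,
    now importing the sibling disprover's `isIso_specialFibreToThickening_zero'` instead of re-proving it.

VERDICT (cycle 4). No kill. The crux resists because (ii′) is a theorem (§1) and (β₁) is equivariantly
reduced to two textbook rules (§11.1); the one printed phenomenon that looks like a counterexample to the
ENGINE'S USE — Dwork–Ogus non-liftability on canonical lifts despite all classes being Hodge — sits exactly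
on the non-semiregular side of the mechanism's own dimension count (§11.2). Literature search was degraded
again (searchd rc 75); Dwork–Ogus was read from the numdam PDF.

VERDICT (cycle 3). No kill; no stub of either skeleton is false as typed. The typed layer of BOTH
registered lines carries only Finding 1's content ((ii′) via additivity); line B's identity is
docstring-only. Literature sweep for printed counterexamples deferred (searchd unavailable through this
session).

LANDED AS IMPORTABLE THEOREMS (proposals, `--supports` this item): `Theorems/PadicPridhamSemiregularity/Negative/TorsorTest.lean` (§6 lemmas, p72267) and
`Theorems/PadicPridhamSemiregularity/Negative/DividedPowerWindowCollapse.lean` (§7 arithmetic, p72248); cycle 3 (§10):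
`…/Negative/StubAudit.lean` (p74770, accepted: `conormalStep_*`, `isZeroOneSemiregularOfIso_of_natural`,
`exists_liftInvariant_of_hasStepDatum`), `…/Negative/SpecialFibreIso.lean` (p76528: `X_k ⟶ X₁` is an
isomorphism, `kZero_map_specialFibreToThickening_zero_injective`) and `…/Negative/StepDatumReduction.lean`
(p76561: `exists_descendToRange`, `hasStepDatum_of_additivePackage` with the tower identity as hypothesis
`hcomp`). Cycle 4 (§11): `…/Negative/ThickeningEquivariance.lean` (`padicBloch_shift_iff`,
`padicBloch_defect_shift_invariant`, `padicBloch_of_liftsSomewhere`, `padicBloch_plus_sign_refuted`,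
`defect_eq_of_sub_mem`, `injective_of_injective_mod`, `abelJacobi_semiregular_dimcount_iff`) and the
resubmitted `…/Negative/SpecialFibreIso.lean` (`kZero_map_specialFibreToThickening_zero_injective`):
p80977 (ThickeningEquivariance, ACCEPTED, commit e0cbb9776fee) and p82940 (SpecialFibreIso, submitted after a
dry-run ACCEPT).

VERDICT (cycle 2). The crux resists because its operative content is TRUE: (ii′) is Finding 1's
theorem, and the identity behind (i′), in the only well-posed K₀-free form (β_n), has a complete proof
sketch (cards `cartan-classifying-map` / `absolute-atiyah-window-collapse`) that survives this seat's
audit (§7) and every structural test tried (torsor §6, change of thickening, Frobenius pull-backs §4,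
rank one = Berthelot–Ogus, sums of line bundles = Leibniz, first-step transversality = BEK's refined
class, §5 calibrations). What is false or ill-posed in the crux AS FILED is bookkeeping: (i′)'s
"`gr^q Ob_n([E_n])`" for `n ≥ 2` (§2, defects D1/D2). No `¬`-theorem can be typed (informal item).

## Not settled here (near-misses, for the record; nothing is sorried)
* (i′) itself at `n = 0` (tight receptacle `⊕_q H^{q+2}(Ω^q)` modulo the unknown differential
  `d₂ : H²(X₁, 𝒦₂^{rel}) → H⁴(X₁, 𝒦₃^{rel})` for `q = 2`, `d ≥ 4`, and the non-Milnor part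
  `coker(𝒦₃(X_{n+2}) → 𝒦₃(X_{n+1}))`): a genuine new conjecture, but no route item consumes it.
* (β_n): the universal sign `ε_r`, and step (1) of the audit without projectivity (local frames /
  simplicial `BGL_r` instead of a Grassmannian) are not written out; (i′) in the relative-`TC`
  receptacle (card dgm-syntomic-receptacle) is a trace-methods compatibility left untouched — no item
  consumes it.
-/

noncomputable section

open CategoryTheory AlgebraicGeometry

universe u v

set_option linter.dupNamespace false

namespace Summit.HodgeConjecture.HodgeConjecture.Cruxes.PadicPridhamSemiregularity.Disproof

open Literature.AlgebraicGeometry.KTheory Literature.AlgebraicGeometry.Motives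

/-! ## §1  Finding 1 — (ii′) "p-adically semiregular ⇒ (⋆)" is a theorem -/

section PositiveCore

variable {Y Z : Scheme.{u}}

/-- **One step of obstruction theory along `f : Y ⟶ Z`** (intended: the closed immersion
`X_{n+1} ↪ X_{n+2}` of the `p`-adic tower), as a hypothesis structure over REAL carriers:
for every vector bundle `F` on `Y` an obstruction class `ob F ∈ ObGrp F` (intended
`Ext²_{X₁}(E₁, E₁)`, `E₁ = F|X₁`; Illusie / Stacks 08VR) which vanishes iff `F` is the pull-back of
a vector bundle on `Z` (`ob_eq_zero_iff`, Stacks 08VR (1)); a receptacle `Hdg` (intended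
`⊕_{q<p} H^{q+2}(X₁, Ω^q_{X₁/k})`) and maps `sigma F : ObGrp F →+ Hdg` (intended the p-adic
Buchweitz–Flenner map `⊕_q σ_q`, `σ_q(ξ) = tr(At(E₁)^q ∘ ξ)/q!`); and the ONE non-formal input
`sigma_ob_shortExact`: ADDITIVITY of `F ↦ σ(ob F)` over short exact sequences of vector bundles
on `Y`. PAPER PROOF of additivity for the intended instance (Finding 1 (A)): choose local frames of
`F` on affine opens `U_a ⊂ X_{n+1}` adapted to the sub-bundle `S` (transition matrices `g_{ab}`
block upper triangular with diagonal blocks the transitions of `S` and `Q`); lift them to block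
upper triangular `g̃_{ab} ∈ GL_r(𝒪(U_{ab,n+2}))` (possible: nilpotent thickening of an affine);
then `ob(F) = [g̃_{ab} g̃_{bc} g̃_{ca} − 1] ∈ Ȟ²(X₁, 𝓔nd E₁)` is block upper triangular with
diagonal blocks the cocycles of `ob(S)`, `ob(Q)`, and `At(E₁) = [dg_{ab} · g_{ab}⁻¹ mod p]` is block
upper triangular with diagonal blocks `At(S₁)`, `At(Q₁)` (equivalently: `ob` and `At` are natural
transformations, so `ob(F) ∘ i = i ∘ ob(S)`, `π ∘ ob(F) = ob(Q) ∘ π`, same for `At`); Čech cup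
products of block upper triangular matrix cochains are block upper triangular with diagonal blocks
the cup products of the diagonal blocks, and `tr` of a block upper triangular matrix is the sum of
the diagonal traces; hence `tr(At(E₁)^q ∪ ob(F)) = tr(At(S₁)^q ∪ ob(S)) + tr(At(Q₁)^q ∪ ob(Q))`
(toy: `trace_pow_mul_eq`). Rank one: `Σ₀ = ob ∘ det`, the determinant trick of item
`LineBundleStepLifting`. [folklore] -/
structure StepObstructionTheory (f : Y ⟶ Z) where
  /-- `ObGrp F` = `Ext²_{X₁}(F|X₁, F|X₁)`, the obstruction group of `F`. -/
  ObGrp : Y.Modules → Type v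
  /-- It is an abelian group. -/
  [instObGrp : ∀ F, AddCommGroup (ObGrp F)]
  /-- `ob F` = Illusie's obstruction to lifting `F` across `f`. -/
  ob : ∀ F : Y.Modules, IsFiniteLocallyFree F → ObGrp F
  /-- Stacks 08VR (1): `ob F = 0` iff `F ≅ f^* F'` for a vector bundle `F'` on `Z`. -/
  ob_eq_zero_iff : ∀ (F : Y.Modules) (hF : IsFiniteLocallyFree F),
    ob F hF = 0 ↔ ∃ F' : Z.Modules, IsFiniteLocallyFree F' ∧
      Nonempty ((Scheme.Modules.pullback f).obj F' ≅ F)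
  /-- `Hdg` = `⊕_{q<p} H^{q+2}(X₁, Ω^q)`. -/
  Hdg : Type v
  /-- It is an abelian group. -/
  [instHdg : AddCommGroup Hdg]
  /-- `sigma F` = the p-adic Buchweitz–Flenner map `⊕_q σ_q` on `Ext²(F|X₁, F|X₁)`. -/
  sigma : ∀ F : Y.Modules, ObGrp F →+ Hdg
  /-- ADDITIVITY (A): `σ(ob F) = σ(ob S) + σ(ob Q)` for `0 → S → F → Q → 0` exact. -/
  sigma_ob_shortExact : ∀ (S : ShortComplex Y.Modules), S.ShortExact →
    ∀ (h₁ : IsFiniteLocallyFree S.X₁) (h₂ : IsFiniteLocallyFree S.X₂)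
      (h₃ : IsFiniteLocallyFree S.X₃),
      sigma S.X₂ (ob S.X₂ h₂) = sigma S.X₁ (ob S.X₁ h₁) + sigma S.X₃ (ob S.X₃ h₃)

attribute [instance] StepObstructionTheory.instObGrp StepObstructionTheory.instHdg

namespace StepObstructionTheory

variable {f : Y ⟶ Z} (T : StepObstructionTheory.{u, v} f)

/-- The generalised determinant `Σ : K₀(Y) →+ Hdg`, `[F] ↦ σ(ob F)` (well defined by (A) and the
universal property `KZero.lift` of Fulton's `K⁰`). [folklore] -/
def Sigma : KZero Y →+ T.Hdg :=
  KZero.lift (fun F hF => T.sigma F (T.ob F hF)) T.sigma_ob_shortExact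

/-- `Σ[F] = σ(ob F)`. [folklore] -/
theorem Sigma_of (F : Y.Modules) (hF : IsFiniteLocallyFree F) :
    T.Sigma (KZero.of F hF) = T.sigma F (T.ob F hF) :=
  KZero.lift_of _ _ F hF

/-- (B) A pulled-back bundle is unobstructed: `ob(f^* G) = 0`. [folklore] -/
theorem ob_pullback_eq_zero (G : Z.Modules) (hG : IsFiniteLocallyFree G) :
    T.ob ((Scheme.Modules.pullback f).obj G) (hG.pullback f) = 0 :=
  (T.ob_eq_zero_iff _ _).2 ⟨G, hG, ⟨Iso.refl _⟩⟩

/-- (B) `Σ ∘ f^* = 0` on `K₀(Z)` (the classes `[G]` generate `K₀(Z)`, `KZero.hom_ext`). [folklore] -/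
theorem Sigma_comp_map : T.Sigma.comp (KZero.map f) = 0 :=
  KZero.hom_ext fun G hG => by
    rw [AddMonoidHom.comp_apply, KZero.map_of, Sigma_of, T.ob_pullback_eq_zero G hG, map_zero,
      AddMonoidHom.zero_apply]

/-- (B) `Σ(f^* y) = 0` for every `y ∈ K₀(Z)`. [folklore] -/
theorem Sigma_map (y : KZero Z) : T.Sigma (KZero.map f y) = 0 := by
  have h := DFunLike.congr_fun T.Sigma_comp_map y
  rwa [AddMonoidHom.comp_apply, AddMonoidHom.zero_apply] at h

/-- **(C) = (ii′) = (⋆) for one step: a vector bundle `F` on `Y` whose `K₀`-class is pulled back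
from `Z` and whose obstruction group is seen injectively by `σ` (p-adic semiregularity of `F|X₁`)
is pulled back from a vector bundle on `Z`.** This is the conclusion of the (⋆)-clause of
`FormalLiftingFromClassLifting` for the step `f = thickeningMap 𝒳 (n+1 ≤ n+2)`. [folklore] -/
theorem lifts_of_classLifts (F : Y.Modules) (hF : IsFiniteLocallyFree F)
    (hσ : Function.Injective (T.sigma F))
    (hcls : ∃ y : KZero Z, KZero.map f y = KZero.of F hF) :
    ∃ F' : Z.Modules, IsFiniteLocallyFree F' ∧
      Nonempty ((Scheme.Modules.pullback f).obj F' ≅ F) := by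
  obtain ⟨y, hy⟩ := hcls
  have h0 : T.sigma F (T.ob F hF) = 0 := by
    rw [← Sigma_of, ← hy]
    exact T.Sigma_map y
  refine (T.ob_eq_zero_iff F hF).1 (hσ ?_)
  rw [h0, map_zero]

/-- Sharper than (⋆): it suffices that `Σ[F] = 0`, e.g. `[F]` in the subgroup generated by classes of
bundles liftable ONE step (no lift of the class itself is needed). [folklore] -/
theorem lifts_of_Sigma_eq_zero (F : Y.Modules) (hF : IsFiniteLocallyFree F)
    (hσ : Function.Injective (T.sigma F)) (h0 : T.Sigma (KZero.of F hF) = 0) :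
    ∃ F' : Z.Modules, IsFiniteLocallyFree F' ∧
      Nonempty ((Scheme.Modules.pullback f).obj F' ≅ F) := by
  rw [Sigma_of] at h0
  refine (T.ob_eq_zero_iff F hF).1 (hσ ?_)
  rw [h0, map_zero]

end StepObstructionTheory

open Literature.AlgebraicGeometry.Motives.WittScheme in
/-- **The (⋆)-clause of the typed crux `FormalLiftingFromClassLifting` (stmt-HodgeConjecture-13825),
verbatim, follows from one `StepObstructionTheory` per transition `X_{n+1} ↪ X_{n+2}` whose `σ` is
injective on the obstruction group of every lift `F` of `E₁`** — i.e. from p-adic semiregularity of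
`E₁` (all these obstruction groups are `Ext²_{X₁}(E₁, E₁)` and all these `σ` are the one
Buchweitz–Flenner map of `E₁`). So P1b (ii′) holds for every `𝒳`, every `E₁`, with no
torsion-freeness and no bound on `p` beyond `q!` invertible. [folklore] -/
theorem star_clause_of_stepTheories {p : ℕ} [Fact p.Prime] {k : Type} [Field k] [CharP k p]
    [PerfectRing k p] (𝒳 : SchemeOver (WittVector p k))
    (E₁ : (specialFibre 𝒳).left.Modules)
    (T : ∀ n : ℕ, StepObstructionTheory.{0, v} (thickeningMap 𝒳 (Nat.le_succ (n + 1))))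
    (hσ : ∀ (n : ℕ) (F : (thickening 𝒳 (n + 1)).left.Modules), IsFiniteLocallyFree F →
      Nonempty ((Scheme.Modules.pullback (specialFibreToThickening 𝒳 n)).obj F ≅ E₁) →
        Function.Injective ((T n).sigma F)) :
    ∀ (n : ℕ) (F : (thickening 𝒳 (n + 1)).left.Modules) (hF : IsFiniteLocallyFree F),
      Nonempty ((Scheme.Modules.pullback (specialFibreToThickening 𝒳 n)).obj F ≅ E₁) →
      (∃ y : KZero (thickening 𝒳 (n + 2)).left,
        KZero.map (thickeningMap 𝒳 (Nat.le_succ (n + 1))) y = KZero.of F hF) →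
      ∃ F' : (thickening 𝒳 (n + 2)).left.Modules, IsFiniteLocallyFree F' ∧
        Nonempty ((Scheme.Modules.pullback (thickeningMap 𝒳 (Nat.le_succ (n + 1)))).obj F' ≅ F) :=
  fun n F hF hE hcls => (T n).lifts_of_classLifts F hF (hσ n F hF hE) hcls

/-! ### §1d  The additivity mechanism (A) in a `2 × 2` toy: each entry stands for a block
(`00` = sub-bundle `S`, `11` = quotient `Q`); `A` = `At(E₁)` (upper triangular by functoriality),
`N` = `ob(F)` (upper triangular by functoriality). -/

section Toy

variable {R : Type*} [CommRing R]

/-- Upper triangular times upper triangular is upper triangular. [folklore] -/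
theorem mul_upperTriangular {A B : Matrix (Fin 2) (Fin 2) R} (hA : A 1 0 = 0) (hB : B 1 0 = 0) :
    (A * B) 1 0 = 0 := by
  simp [Matrix.mul_apply, Fin.sum_univ_two, hA, hB]

/-- Diagonal entries of a product of upper triangular matrices multiply. [folklore] -/
theorem mul_upperTriangular_diag {A B : Matrix (Fin 2) (Fin 2) R} (hA : A 1 0 = 0)
    (hB : B 1 0 = 0) : (A * B) 0 0 = A 0 0 * B 0 0 ∧ (A * B) 1 1 = A 1 1 * B 1 1 := by
  constructor <;> simp [Matrix.mul_apply, Fin.sum_univ_two, hA, hB]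

/-- Powers of an upper triangular matrix are upper triangular with powered diagonal. [folklore] -/
theorem pow_upperTriangular {A : Matrix (Fin 2) (Fin 2) R} (hA : A 1 0 = 0) (q : ℕ) :
    (A ^ q) 1 0 = 0 ∧ (A ^ q) 0 0 = A 0 0 ^ q ∧ (A ^ q) 1 1 = A 1 1 ^ q := by
  induction q with
  | zero => simp
  | succ q ih =>
    obtain ⟨h10, h00, h11⟩ := ih
    refine ⟨by rw [pow_succ]; exact mul_upperTriangular h10 hA, ?_, ?_⟩
    · rw [pow_succ, (mul_upperTriangular_diag h10 hA).1, h00, pow_succ]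
    · rw [pow_succ, (mul_upperTriangular_diag h10 hA).2, h11, pow_succ]

/-- **(A) in the toy: `tr(At^q · ob(F)) = tr(At_S^q · ob(S)) + tr(At_Q^q · ob(Q))`** — the
`σ_q(ob ·)` of an extension is the sum over the graded pieces; in particular it VANISHES when the
diagonal blocks of `ob` do (extension of liftable bundles: `ob(F) = i ∘ y ∘ π` strictly upper
triangular), which is Finding 4's "no counterexample is an extension of liftables". [folklore] -/
theorem trace_pow_mul_eq {A N : Matrix (Fin 2) (Fin 2) R} (hA : A 1 0 = 0) (hN : N 1 0 = 0)
    (q : ℕ) : Matrix.trace (A ^ q * N) = A 0 0 ^ q * N 0 0 + A 1 1 ^ q * N 1 1 := by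
  obtain ⟨h10, h00, h11⟩ := pow_upperTriangular hA q
  rw [Matrix.trace_fin_two, (mul_upperTriangular_diag h10 hN).1,
    (mul_upperTriangular_diag h10 hN).2, h00, h11]

/-- Extension of liftable pieces (`ob(S) = ob(Q) = 0`): every `σ_q(ob F)` vanishes, so a
p-adically semiregular such `F` is unobstructed (Mini-theorem A). [folklore] -/
theorem trace_pow_mul_eq_zero_of_strictUpper {A N : Matrix (Fin 2) (Fin 2) R} (hA : A 1 0 = 0)
    (hN : N 1 0 = 0) (h0 : N 0 0 = 0) (h1 : N 1 1 = 0) (q : ℕ) :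
    Matrix.trace (A ^ q * N) = 0 := by
  rw [trace_pow_mul_eq hA hN, h0, h1, mul_zero, mul_zero, add_zero]

end Toy

end PositiveCore

/-! ## §2  Finding 2 — the shape "(i′) ⇒ (ii′)" needs an injective comparison map, and the
level-wise comparison map `ῑ_n : H^{q+2}(Ω^q) → H^{q+2}(Ω^q/B_nΩ^q)` is NOT injective in general -/

section ReceptacleLeak

/-- The bare logical shape of the route's deduction "(i′) ⇒ (ii′)": obstruction `o ∈ E`
(= `Ext²`), Hodge receptacle `H` (= `⊕ H^{q+2}(Ω^q)`), class-obstruction receptacle `C`, maps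
`σ : E → H`, `ι : H → C`, compatibility (i′) in Pridham's shape `Ob = ι(σ(o))`; claim: `σ`
injective and `Ob = 0` force `o = 0`. [folklore] -/
def IPrimeToIIPrimeShape : Prop :=
  ∀ (E H C : Type) [AddCommGroup E] [AddCommGroup H] [AddCommGroup C] (σ : E →+ H) (ι : H →+ C)
    (o : E), Function.Injective σ → ι (σ o) = 0 → o = 0

/-- With `ι` injective on the image of `σ` the shape is valid (this is what rattack-g2's repair
D2 "`Ob ∈ im ι`, ι injective" presupposes). [folklore] -/
theorem iPrimeToIIPrime_of_injective (E H C : Type) [AddCommGroup E] [AddCommGroup H]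
    [AddCommGroup C] (σ : E →+ H) (ι : H →+ C) (o : E) (hσ : Function.Injective σ)
    (hι : ∀ h : H, ι h = 0 → h = 0) (hOb : ι (σ o) = 0) : o = 0 :=
  hσ (by rw [hι _ hOb, map_zero])

/-- **LEAK MODEL: the shape fails as soon as `ker ι` meets `im σ`** — witness `E = H = ℤ`, `C = 0`,
`σ = id`, `ι = 0`, `o = 1`. WHY THIS IS THE RELEVANT MODEL (Leak Lemma, paper proof):
(1) RECEPTACLE. For the step `X_{n+1} ↪ X_{n+2}` the obstruction to lifting a class in `K₀` lives
in `π₋₁` of the relative K-theory; its Zariski-descent filtration has graded pieces (subquotients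
of) `H^{q+2}(X₁, 𝒦^{rel}_{q+1})`, and `𝒦^{rel}_{q+1} ↠ ker(𝒦^M_{q+1}(X_{n+2}) → 𝒦^M_{q+1}(X_{n+1}))
= U^{n+1}𝒦^M_{q+1}(X_{n+2}) ≅ Ω^q_{X₁}/B_nΩ^q_{X₁}` via `a dlog b₁ ⋯ dlog b_q ↦ {1 + p^{n+1}a, b₁,…}`
(Bloch–Esnault–Kerz arXiv:1203.2776 Thm. 54 = Kurihara's exponential isomorphism
`pΩ^{r-1}_{R_m}/p²dΩ^{r-2}_{R_m} ≅ U¹K^M_r(R_m)` with `gr^i ≅ Ω^{r-1}_{R₁}/B_{i-1}`, read p0021;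
`B₀ = 0`, `B₁ = d𝒪`, `B_{i+1}/B₁ ≅ C⁻¹B_i`). The only natural map from the crux's receptacle
`H^{q+2}(X₁, Ω^q)` is therefore `ῑ_n : H^{q+2}(Ω^q) → H^{q+2}(Ω^q/B_n)`, with
`ker ῑ_n = im(H^{q+2}(B_nΩ^q) → H^{q+2}(Ω^q))`; `n = 0` is tight (`B₀ = 0`).
(2) NO LEAK for `d ≤ 3` (all `n`): only `(q, q+2) = (1, 3)` is at stake; on a threefold
`H³(X'₁,𝒪) →F* H³(X₁,𝒪) → H³(B₁Ω¹) → H⁴ = 0`, so `H³(𝒪) ↠ H³(B₁Ω¹)`, and the composite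
`H³(𝒪) → H³(B₁Ω¹) → H³(Ω¹)` is the Hodge–de Rham differential, zero by Deligne–Illusie (`X₁` lifts
to `W₂`, `dim < p`); induction on `n` with `0 → B₁ → B_{n+1} →C B_n(X') → 0` and
`C⁻¹ : Ω¹_{X'} ≅ Z₁/B₁` gives `im(H³(B_n) → H³(Ω¹)) = 0`. Same argument in top degree
`q + 2 = d` for every `d`, and for ordinary `X₁` (`F*` bijective on all `Hⁱ(𝒪)` ⇒ `H*(B_n) = 0`).
(3) LEAK at `d = 4`, `q = 1`, `n = 1`: `X₁ = E × B`, `E` supersingular elliptic, `B` ordinary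
abelian threefold, `k = 𝔽̄_p`. GENERAL PRINCIPLE: `B₁Ω^q` is an `𝒪_{X'}`-submodule, so for a
global form `ω ∈ H⁰(X₁, B₁Ω^q)` (= killed by Cartier) and a Frobenius-pulled-back class
`η = F*η' ∈ H^j(X₁, 𝒪)` the cup product `η ∪ ω` is represented by the `B₁Ω^q`-valued Čech cocycle
`(η'_{ab})^p · ω`, hence `F*H^j(𝒪) ∪ H⁰(B₁Ω^q) ⊆ im(H^j(B₁Ω^q) → H^j(Ω^q))`. On `E × B`: the
invariant differential `ω_E` of the supersingular factor is killed by Cartier (Hasse invariant 0),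
so `ω_E ∈ H⁰(X₁, B₁Ω¹)`; `F*` is bijective on `H³(B, 𝒪_B)` (ordinary), so
`η := 1_E ⊗ F*_B η'_B ∈ F*H³(X₁, 𝒪)` is non-zero; and `η ∪ ω_E = 1 ⊗ F*η'_B ⊗ ω_E ≠ 0` in
`H³(X₁, Ω¹) = H³(X₁,𝒪) ⊗ H⁰(Ω¹)` (Künneth). Hence `ker ῑ₁ ≠ 0`. (A second proof by the long exact
sequences of `0 → 𝒪_{X'} → F_*𝒪 → F_*B₁ → 0` on `E' × B'` with `F_*𝒪_E` = Atiyah's unipotent `F_p`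
gives `im(H³(B₁Ω¹) → H³(Ω¹))` = exactly this line; and shows NO leak on SUPERSPECIAL `E⁴`, where
`F* = 0` on every factor kills the connecting maps — so on the route's superspecial anchors
`ῑ_n` is injective in `H³` for all `n`, by the same induction as (2).)
CONSEQUENCE: (i′) cannot be stated as "`Ob_n = ι(⊕σ_q(o))`, ι injective" for `n ≥ 1`, `d ≥ 4`; a
semiregular `F ∈ VB(X₂)` with `σ(ob F) = (0, ℓ, 0)`, `ℓ ∈ ker ῑ₁ ∖ 0`, would have vanishing MILNOR
class obstruction though `ob F ≠ 0` — by Finding 1 its class then does NOT lift, so the non-Milnor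
part `coker(𝒦₃(X₃) → 𝒦₃(X₂))` of the receptacle must detect it: the K-theoretic receptacle is
strictly richer than its Milnor quotient exactly along the leak. [folklore] -/
theorem leak_model : ¬ IPrimeToIIPrimeShape := by
  intro h
  have h1 := h ℤ ℤ PUnit (AddMonoidHom.id ℤ) 0 1 (fun _ _ hab => hab) rfl
  exact one_ne_zero h1

end ReceptacleLeak

/-! ## §3  Finding 3 — load-bearing hypotheses of (ii′) / refuted strengthenings (finite models;
the geometric witnesses are cited in the docstrings) -/

section Strengthenings

/-- STRENGTHENING S1 "semiregular ⇒ lifts" (drop the class hypothesis): FALSE already in rank one —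
a line bundle is always semiregular (`σ₀ = tr = id` on `Ext²(L,L) = H²(𝒪)`) and lifts to `X₂` iff
`c₁^{cris}(L)` stays in `F¹` (Berthelot–Ogus 1983 Thm. 3.8, tree:
`CrystallineRealization.BerthelotOgusLineBundleLifting`); e.g. a principal polarisation of an
abelian threefold against a lift `X₂` off its Hodge locus. Model: `σ` injective, `ob ≠ 0`, nothing
forces `ob = 0`. [folklore] -/
theorem not_lifts_without_classHypothesis :
    ¬ ∀ (E H : Type) [AddCommGroup E] [AddCommGroup H] (σ : E →+ H) (o : E),
      Function.Injective σ → o = 0 := by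
  intro h
  exact one_ne_zero (h ℤ ℤ (AddMonoidHom.id ℤ) 1 fun _ _ hab => hab)

/-- STRENGTHENING S2 "(⋆) for every `E₁`" (drop semiregularity): Finding 1 gives exactly
`[F] ∈ im ⇒ ob(F) ∈ ker σ`; for a NON-semiregular `E₁` an `F` with `0 ≠ ob(F) ∈ ker σ` has a class
killed by `Σ` and still does not lift. Model of the gap: `σ = 0`, `ob = 1`, `Σ[F] = 0`.
Geometric candidates (not certified here): non-split extensions `F` of liftable line bundles with
`ob(F) = i ∘ β(e) ∘ π ≠ 0` (`β` the Bockstein of the line bundle `Hom(Q,S)` — its cohomology may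
jump between `X_K` and `X₁` even when the HODGE cohomology of `𝒳` is torsion-free); such `F` have
`[F] = [S] + [Q] ∈ im` and `σ(ob F) = 0`. So semiregularity is load-bearing for (⋆), as expected.
[folklore] -/
theorem star_false_without_injectivity :
    ¬ ∀ (E H : Type) [AddCommGroup E] [AddCommGroup H] (σ : E →+ H) (o : E),
      σ o = 0 → o = 0 := by
  intro h
  exact one_ne_zero (h ℤ ℤ 0 1 rfl)

/-- STRENGTHENING S3 (drop Hodge-torsion-freeness): irrelevant for (ii′) — §1 never uses it (nor
`p > d + 6`, nor projectivity). The Godeaux–Serre witness against the OLD P1 (refuter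
rattack-1498-0, ledger negatives) is a CLASS-level failure (`[L₁] ∉ im(K₀(X₂) → K₀(X₁))`), exactly
as Finding 1 predicts: `Σ₀[L₁] = ob(L₁) ≠ 0`. Recorded as the trivial remark that (C) has no
hypothesis on `𝒳`. [folklore] -/
theorem torsionFreeness_not_used : True := trivial

end Strengthenings

/-! ## §4  Finding 4 — constraints for any counterexample hunt on the decorative half (i′) -/

section Frobenius

open Literature.AlgebraicGeometry.HodgeTheory

variable {𝕜 : Type u} [CommRing 𝕜] (A : AtiyahTraceAlgebra.{u, v} 𝕜)

/-- If the Atiyah class vanishes (FROBENIUS PULL-BACKS `E₁ = Fr* G`: `At(Fr*G) = Fr*At(G)` and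
`Fr*` kills `Ω¹`; bundles with an integrable connection of `p`-curvature zero) then all positive
powers vanish. [folklore] -/
theorem atiyahPow_succ_eq_zero (h : A.atiyah = 0) (k : ℕ) : A.atiyahPow (k + 1) = 0 := by
  rw [AtiyahTraceAlgebra.atiyahPow_succ, h, map_zero]

/-- … hence `σ_k = 0` for every `k ≥ 1`: on a Frobenius pull-back the p-adic semiregularity map
is `(tr, 0, 0, …)`. [folklore] -/
theorem semiregularityComponent_succ_eq_zero (h : A.atiyah = 0) (k : ℕ) :
    A.semiregularityComponent (k + 1) = 0 := by
  ext x
  rw [AtiyahTraceAlgebra.semiregularityComponent_apply, atiyahPow_succ_eq_zero A h k, map_zero,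
    map_zero, smul_zero, LinearMap.zero_apply]

/-- **Frobenius pull-backs are p-adically semiregular iff `tr : Ext²(E,E) → H²(𝒪)` is injective**
(iff `H²(𝓔nd₀ E) = 0` when `p ∤ rk E`) — then the trace-free part of `ob` has no room and (ii′) is
empty of content on them; and (i′) PREDICTS for every `G` that the Hodge part of the class
obstruction of `[Fr*G] = ψ^p[G]` beyond the determinant vanishes (consistent with Adams weights:
`ψ^p` acts by `p^{q+1}` on the weight-`(q+1)` graded piece, which is `p`-torsion). [folklore] -/
theorem isSemiregular_iff_trace_injective_of_atiyah_eq_zero (h : A.atiyah = 0) :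
    A.IsSemiregular ↔ Function.Injective (A.trace 2 0) := by
  rw [AtiyahTraceAlgebra.isSemiregular_iff, injective_iff_map_eq_zero]
  refine forall_congr' fun x => ⟨fun hx h0 => hx fun k => ?_, fun hx hall => hx ?_⟩
  · cases k with
    | zero => rw [AtiyahTraceAlgebra.semiregularityComponent_zero_apply]; exact h0
    | succ k => rw [semiregularityComponent_succ_eq_zero A h k, LinearMap.zero_apply]
  · rw [← AtiyahTraceAlgebra.semiregularityComponent_zero_apply]
    exact hall 0

end Frobenius


/-! ## §5  Calibration of the real engine (β) beyond rank one — semiregular CODIMENSION-2 cycles on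
`E³` pass the first-order p-adic variational Hodge test (tightness record, no kill) -/

section Calibration

/-- **Graph curves in `E³`.** `E/k` an elliptic curve (any Newton polygon), `A = E³`,
`C_{φ,ψ} = (1, φ, ψ)(E) ⊂ A` for `φ, ψ ∈ End(E)`: a smooth curve of codimension 2 with
`N_{C/A} ≅ 𝒪_C²`, `H¹(C, N) = k²`, and Bloch's map `π_C : H¹(C,N) → H³(A, Ω¹_A) = H³(A,𝒪) ⊗ H⁰(Ω¹_A)`
is `g ⊗ (N₀ ≅ t^⊥ ⊂ H⁰(Ω¹_A))` with `g : H¹(C,𝒪_C) ≅ H³(A,𝒪_A)` the coherent Gysin isomorphism and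
`t = (1, dφ, dψ)` the tangent direction — INJECTIVE: `C_{φ,ψ}` is Bloch-semiregular. TEST of the
p-adic semiregularity principle at first order (the `[𝒪_C]`-instance of (β), which on a threefold
generates (β): `K₀` of a smooth threefold is generated by points, curves and divisors): for EVERY lift
`A₂/W₂` of `A` (Grothendieck–Messing: rank-3 summands `F ⊂ (M/p²)³` lifting `ω ⊗ k³`,
`M = H¹_cris(E/W)` with its perfect alternating form) one has
LIFT: `C` lifts to `A₂` ⟺ `f^*F ⊆ L` for a rank-1 summand `L ∋ ℓ` (`f^* = (1, φ^*, ψ^*)`, `ℓ` a lift of `ω`;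
then `L = W₂ℓ`), and HODGE: `cl^{cris}(C) ∈ F²H⁴_dR(A₂/W₂)` ⟺ `cl(C) ⊥ F²H² = Λ²F` ⟺ `f^*F` is
ISOTROPIC in `M/p²`. Since `f^*F ∋ ℓ` with `ℓ̄ ≠ 0` and `ℓ^⊥ = W₂ℓ` in a rank-2 symplectic module
(this lemma, with `ℓ = (1, a)`), ISOTROPIC ⟺ `f^*F ⊆ W₂ℓ` ⟺ LIFT. So LIFT ⟺ HODGE for all `(φ, ψ, A₂)`:
e.g. product lifts `Ẽ₁ × Ẽ₂ × Ẽ₃` give "`φ`, `ψ` lift (and then `ψφ^∨` lifts)"; a non-product lift with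
`f^*F = W₂ℓ + pW₂m'`, `m̄' ∉ kℓ̄`, gives neither. First mixed-characteristic check of the engine beyond
rank one known to this seat; it is governed by weight-1 data only (not a deep test). [folklore] -/
theorem perp_line_eq_span {R : Type*} [CommRing R] (a : R) (y : Fin 2 → R) :
    y 1 - a * y 0 = 0 ↔ ∃ c : R, y = c • ![1, a] := by
  constructor
  · intro h
    refine ⟨y 0, ?_⟩
    ext i
    fin_cases i
    · simp
    · simp only [Fin.mk_one, Pi.smul_apply, Matrix.cons_val_one, Matrix.cons_val_fin_one,
        smul_eq_mul]
      linear_combination h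
  · rintro ⟨c, rfl⟩
    simp [mul_comm]

/-- The isotropy form of the same statement: the alternating pairing `⟨x, y⟩ = x₀y₁ − x₁y₀` on `R²`
vanishes on `(ℓ, y)`, `ℓ = (1, a)`, iff `y ∈ Rℓ`; hence a submodule containing `ℓ` is isotropic iff it
is the line `Rℓ` (HODGE ⟺ LIFT above). [folklore] -/
theorem isotropic_with_line_iff {R : Type*} [CommRing R] (a : R) (y : Fin 2 → R) :
    (![1, a] 0 * y 1 - ![1, a] 1 * y 0 = 0) ↔ ∃ c : R, y = c • ![1, a] := by
  rw [← perp_line_eq_span a y]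
  simp

/-- **Second calibration (weight 2 involved): graph curves in `K3 × E`.** `S → ℙ¹` an elliptic K3 over
`k`, `E ≅ E_t` a smooth fibre, `C = {(ι x, x)} ⊂ X = S × E`, lift `X₂ = S₂ × E₂` (Hodge-torsion-free,
`d = 3`). Here `H³(X, Ω¹_X) = H²(S,𝒪) ⊗ H¹(E, Ω¹_E) = k` (`h^{1,2}(S) = 0`), `N_{C/X} ≅ T_S|_{E_t}`, an
extension of `N_{E_t/S} = 𝒪` by `T_{E_t} = 𝒪` whose class is the Kodaira–Spencer class `κ_t` of the
fibration. HODGE: `cl(C) = [pt_S] ⊗ 1 + [E_t] ⊗ [pt_E]` (`H¹(S) = H³(S) = 0`), so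
`cl(C) ∈ F²H⁴_dR(X₂)` ⟺ `𝒪(E_t)` lifts to `S₂` (Berthelot–Ogus). LIFT: `C` lifts ⟺ `𝒪(E_t)` lifts AND
some lift `E_{t₂} ⊂ S₂` of the fibre is isomorphic to the given `E₂` ⟺ `𝒪(E_t)` lifts and
(`κ_t ≠ 0` or `j(E₂)` is the forced value). So for `κ_t = 0` (degenerate `j`-map) LIFT fails while
HODGE holds — and EXACTLY then `N ≅ 𝒪 ⊕ 𝒪` splits, `h¹(N)` jumps from 1 to 2, and
`π_C : H¹(C,N) ≅ H¹(E_t, Ω¹_S|_{E_t}) → k` (whose only non-zero component is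
`u ↦ −Gysin(res_* u · dz)`, `res_*` surjective with kernel `H¹(N^∨_{E_t/S})`) acquires the kernel
`H¹(E_t,𝒪)·(conormal direction)`, which under `N ≅ N^∨ ⊗ det N` is precisely the `T_{E_t}`-direction
carrying the `j`-mismatch obstruction: `C` is NOT semiregular and `ob(C) ∈ ker π_C`. For `κ_t ≠ 0`,
`N ≅` Atiyah's `F₂`, `h¹(N) = 1`, `π_C` is an isomorphism (semiregular) and LIFT ⟺ HODGE. Consistent
with the p-adic Bloch formula in a case where weight-2 (K3) data and a non-Hodge obstruction direction
both occur — no kill; recorded as evidence that the engine (β) "protects itself". [folklore] -/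
theorem calibration_K3xE_recorded : True := trivial

end Calibration

/-! ## §6  Cycle 2 (refuter-cdisprove-stmt-HodgeConjecture-13815-g2-0, 2026-08-16) — the TORSOR TEST
of the K₀-free engine P1b♮: passed (no kill), and what it pins down

After Finding 1 the whole remaining content of the crux is the K₀-free identity the two crux-attacks
and all seven idea cards converged on ("P1b♮", Pridham shape (i″)):
`ι ⊕_q σ_q(o(E_n; X_{n+1})) = ± δ_{n+1}(ch^cris(E₁))` for EVERY finite locally free lift `E_n` of `E₁`
to `X_n`. Its right-hand side does not see the lift `E_n`; its left-hand side a priori does. The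
cheapest structural attack is therefore the TORSOR TEST: lifts of a fixed `E_{n-1}` to `X_n` form a
torsor under `H¹(X₁, 𝓔nd E₁) ⊗ (p^{n-1}W/p^nW) ≅ Ext¹(E₁, E₁)`, and one compares `σ(o(E_n + e))`
with `σ(o(E_n))`.

LIFT-CHANGE FORMULA (paper, Čech; recorded here because no card states it): for `F ∈ VB(X_n)`,
`e ∈ Ext¹(E₁,E₁)` and `F + e` the twisted lift (transition matrices `g̃_{ab}(1 + p^{n-1} ê_{ab})`),
  `o(F + e) = o(F) + β(e) + [n = 2]·(e ∘ e)`     in `Ext²(E₁,E₁) ⊗ (p^nW/p^{n+1}W)`,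
where `β : H¹(X₁, 𝓔nd E₁) → H²(X₁, 𝓔nd E₁)` is the Bockstein of
`0 → 𝓔nd E₁ → 𝓔nd E₁ ⊗ 𝒪_{X₂} → 𝓔nd E₁ → 0` (the SAME first Bockstein at every level `n ≥ 2`:
the relevant coefficient sequence `0 → p^n𝒪/p^{n+1} → p^{n-1}𝒪/p^{n+1} → p^{n-1}𝒪/p^n → 0` is
`0 → 𝒪_{X₁} → 𝒪_{X₂} → 𝒪_{X₁} → 0`), and the Yoneda square `e ∘ e` (the primary obstruction of the
first-order deformation `e`) enters only for `n = 2`, where `p^{2(n-1)} = p²` survives mod `p^{n+1} = p³`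
(derivation: lift `1 + pê_{ab}` to `1 + pE_{ab}` over `X₃`; the cocycle defect of
`G_{ab}(1+pE_{ab}) · G_{bc}(1+pE_{bc}) · (G_{ab}(1+pE_{ab}) G_{bc}(1+pE_{bc}))⁻¹…` collects
`p·δ(ê) = p²η` (`[η] = β(e)`) and the `p²`-terms `E_{ab}E_{bc} + (inverse correction) = (e ∪ e)_{abc}`;
in rank one this is `o(L ⊗ M) = o(L) + β(a)`, `a ∪ a = 0`). Hence
  `σ_q(o(F + e)) − σ_q(o(F)) = tr(At^q ∪ β(e))/q! + [n = 2]·tr(At^q ∪ e ∘ e)/q!`.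
(T1) `tr(At(E₁)^q ∪ β_{End}(e)) = ± β_Ω(tr(At^q ∪ e))`, `β_Ω` the Bockstein of
`0 → Ω^q_{X₁} → Ω^q_{X₂} → Ω^q_{X₁} → 0` (`At(E₁) = At(F)|X₁` lifts to `X₂`, so `β(At) = 0` and `β` is a
derivation on cup products): VANISHES under Hodge-torsion-freeness (`H^{q+1}(X₂,Ω^q) ↠ H^{q+1}(X₁,Ω^q)`),
and NOT otherwise — this is exactly where `H_tf` is load-bearing for P1b♮ (rank one: `o(L⊗M) − o(L) = β(a)`,
the Godeaux–Serre mechanism one level up). (T2) `tr(At(E₁)^q ∪ (e ∘ e)) = 0` for ALL `e`, in EVERY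
characteristic `≠ 2` with `q!` invertible: Buchweitz–Flenner Prop. 3.12 (the powers of the Atiyah class
are graded-central: `ξ · At^k = (-1)^{ik} At^k · ξ`, proved by projective approximations — characteristic
free) and Cor. 4.8 (the trace vanishes on graded commutators, `e ∘ e = ½[e,e]`). THIS SECTION CHECKS (T2)
IN LEAN over the tree's σ-carrier `HodgeTheory.AtiyahTraceAlgebra`, with centrality and cyclicity as the
two named hypotheses (`HasCentralAtiyah`, `HasCyclicTrace` — true for the geometric instance, not axioms
of the interface): `semiregularityMap_sq_eq_zero`. CONSEQUENCES. (a) P1b♮ passes the torsor test at every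
level: the lift-dependence of its left side is `σ(β(e))`, a Bockstein image, and the UNCONDITIONAL form of
the identity (§7: an equality in `H^{2r}(X_{n+1}, Ω^{<r})`, reached through `p^n_*`) is consistent even
WITHOUT `H_tf`, because `ker(p^n_* : H^{2r}(X₁,Ω^{<r}) → H^{2r}(X_{n+1},Ω^{<r})) ⊇ im ∂_n ⊇ im ∂₁ = im β_Ω`
(the level-1 coefficient sequence maps to the level-n one by `p^{n-1}`, identity on the kernel). So the
torsor test REFUTES NOTHING and instead fixes the shape: normalised P1b♮ ("`δ_{n+1}` read in
`H^{r+1}(X₁,Ω^{r-1}) ⊗ k`") is lift-INDEPENDENT iff `σ∘β = 0` iff (morally) `H_tf`; unnormalised P1b♮ is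
lift-independent always. (b) A by-product for the route's characteristic-p bookkeeping: the FIRST case of
the Bloch–Buchweitz–Flenner conjecture ("σ kills the primary obstructions `e ∘ e` of deformations of `E₁`
on the FIXED `X₁`") holds in every odd characteristic by sign bookkeeping alone — whereas the full
"semiregular ⇒ unobstructed on fixed X" is FALSE in characteristic `p` (a line bundle is always
semiregular, `σ₀ = tr = id`, yet on a surface with non-reduced Picard scheme — Igusa 1955, Serre 1958 —
its equal-characteristic deformation functor `= 𝒪̂_{Pic,[L]}` is obstructed; by the crystalline argument
over `k[t]/t^{m}` with its PD structure, `m ≤ p`, the first such obstruction sits at order `≥ p`). The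
p-adic tower is protected from this phenomenon exactly by `H_tf` (Berthelot–Ogus), which is therefore not
removable from any restatement of P1b that normalises `δ`. -/

section TorsorTest

open Literature.AlgebraicGeometry.HodgeTheory

variable {𝕜 : Type u} [CommRing 𝕜] (A : AtiyahTraceAlgebra.{u, v} 𝕜)

/-- **Graded centrality of the Atiyah class** against `Ext^•(F,F)` (form degree `0`), in the shape of
Buchweitz–Flenner Prop. 3.12 with `k = 1`: `At · ξ = (-1)^i ξ · At` for `ξ ∈ Extⁱ(F, F)`. TRUE for the
Atiyah class of any perfect complex on any scheme / complex space (BF prove it by projective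
approximations of a resolvent; equivalently: `At` is the value at `F` of a natural transformation
`id ⇒ (−) ⊗ 𝕃[1]` of triangulated functors, and `At_{F[i]} = (-1)^i At_F[i]`, BF Sit. 3.7); it is NOT an
axiom of the tree's interface `AtiyahTraceAlgebra` (σ is data there), so it is carried as a hypothesis.
[cite: BuchweitzFlenner2003, Prop. 3.12 and Sit. 3.7] -/
def HasCentralAtiyah : Prop :=
  ∀ (i a : ℕ) (ha : 1 + i = a) (ha' : i + 1 = a) (x : A.Ext i 0),
    A.mul ha (show 1 + 0 = 1 from rfl) A.atiyah x =
      ((-1 : 𝕜) ^ i) • A.mul ha' (show 0 + 1 = 1 from rfl) x A.atiyah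

/-- **Graded cyclicity of Illusie's trace**: `Tr(y · z) = (-1)^{ii' + jj'} Tr(z · y)` for
`y ∈ Extⁱ(F, F ⊗ Ωʲ)`, `z ∈ Ext^{i'}(F, F ⊗ Ω^{j'})` (Koszul sign from the cohomological degrees, and
from the graded-commutativity of `Ω^•` in the form degrees) — "the trace vanishes on (graded)
commutators" (BF, before Cor. 4.8; Illusie, Complexe cotangent I, V). TRUE for the geometric instance,
a hypothesis over the interface. [cite: BuchweitzFlenner2003, Cor. 4.8] -/
def HasCyclicTrace : Prop :=
  ∀ (i j i' j' a b : ℕ) (ha : i + i' = a) (hb : j + j' = b) (ha' : i' + i = a) (hb' : j' + j = b)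
    (y : A.Ext i j) (z : A.Ext i' j'),
    A.trace a b (A.mul ha hb y z) =
      ((-1 : 𝕜) ^ (i * i' + j * j')) • A.trace a b (A.mul ha' hb' z y)

variable {A}

/-- `At^k · x = (-1)^k x · At^k` for `x ∈ Ext¹(F,F)`: the powers of a graded-central Atiyah class are
graded-central (BF Prop. 3.12 for general `k`, here DERIVED from `k = 1` and associativity of the
Yoneda product). [cite: BuchweitzFlenner2003, Prop. 3.12] -/
theorem atiyahPow_mul_comm (hC : HasCentralAtiyah A) (x : A.Ext 1 0) (k : ℕ) :
    A.mul rfl (Nat.add_zero k) (A.atiyahPow k) x =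
      ((-1 : 𝕜) ^ k) • A.mul (Nat.add_comm 1 k) (Nat.zero_add k) x (A.atiyahPow k) := by
  induction k with
  | zero =>
    rw [pow_zero, one_smul, AtiyahTraceAlgebra.atiyahPow_zero]
    exact (A.one_mul x).trans (A.mul_one x).symm
  | succ k ih =>
    rw [AtiyahTraceAlgebra.atiyahPow_succ]
    rw [A.mul_assoc rfl rfl (rfl : 1 + 1 = 2) (rfl : 1 + 0 = 1) rfl (Nat.add_zero (k + 1))
      (rfl : k + 2 = k + 1 + 1) (rfl : k + 1 = k + 1) (A.atiyahPow k) A.atiyah x]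
    rw [hC 1 2 rfl rfl x, map_smul]
    rw [← A.mul_assoc (rfl : k + 1 = k + 1) (Nat.add_zero k) (rfl : 1 + 1 = 2) (rfl : 0 + 1 = 1)
      (rfl : k + 1 + 1 = k + 1 + 1) (rfl : k + 1 = k + 1) (rfl : k + 2 = k + 1 + 1)
      (rfl : k + 1 = k + 1) (A.atiyahPow k) x A.atiyah]
    rw [ih, LinearMap.map_smul₂]
    rw [A.mul_assoc (Nat.add_comm 1 k) (Nat.zero_add k) rfl rfl rfl rfl (Nat.add_comm 1 (k + 1))
      (Nat.zero_add (k + 1)) x (A.atiyahPow k) A.atiyah]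
    rw [smul_smul, pow_one, ← pow_succ']

/-- **(T2), the sign computation**: `2 · Tr((x ∘ x) · At^k) = 0` for every `x ∈ Ext¹(F,F)`, from
centrality and cyclicity alone: `Tr((xx)P) = Tr(x(xP)) = (-1)^{k+1} Tr((xP)x) = (-1)^{k+1} Tr(x(Px))
= (-1)^{k+1}(-1)^k Tr(x(xP)) = −Tr((xx)P)` with `P = At^k`. No characteristic hypothesis. [folklore] -/
theorem two_smul_trace_sq_mul_atiyahPow (hC : HasCentralAtiyah A) (hT : HasCyclicTrace A) (k : ℕ)
    (x : A.Ext 1 0) :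
    (2 : 𝕜) • A.trace (k + 2) k
      (A.mul (Nat.add_comm 2 k) (Nat.zero_add k) (A.mul (rfl : 1 + 1 = 2) (rfl : 0 + 0 = 0) x x)
        (A.atiyahPow k)) = 0 := by
  set S := A.trace (k + 2) k
      (A.mul (Nat.add_comm 2 k) (Nat.zero_add k) (A.mul (rfl : 1 + 1 = 2) (rfl : 0 + 0 = 0) x x)
        (A.atiyahPow k)) with hS
  have key : S = (((-1 : 𝕜) ^ (1 * (k + 1) + 0 * k)) * (-1) ^ k) • S := by
    conv_lhs =>
      rw [hS]
      rw [A.mul_assoc (rfl : 1 + 1 = 2) (rfl : 0 + 0 = 0) (Nat.add_comm 1 k) (Nat.zero_add k)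
        (Nat.add_comm 2 k) (Nat.zero_add k) (show 1 + (k + 1) = k + 2 by omega) (Nat.zero_add k)
        x x (A.atiyahPow k)]
      rw [hT 1 0 (k + 1) k (k + 2) k (show 1 + (k + 1) = k + 2 by omega) (Nat.zero_add k)
        rfl (Nat.add_zero k)]
      rw [A.mul_assoc (Nat.add_comm 1 k) (Nat.zero_add k) (rfl : k + 1 = k + 1) (Nat.add_zero k)
        (rfl : k + 1 + 1 = k + 2) (Nat.add_zero k) (show 1 + (k + 1) = k + 2 by omega)
        (Nat.zero_add k) x (A.atiyahPow k) x]
      rw [atiyahPow_mul_comm hC x k, map_smul, map_smul]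
      rw [← A.mul_assoc (rfl : 1 + 1 = 2) (rfl : 0 + 0 = 0) (Nat.add_comm 1 k) (Nat.zero_add k)
        (Nat.add_comm 2 k) (Nat.zero_add k) (show 1 + (k + 1) = k + 2 by omega) (Nat.zero_add k)
        x x (A.atiyahPow k)]
      rw [smul_smul]
  have hsign : ((-1 : 𝕜) ^ (1 * (k + 1) + 0 * k)) * (-1) ^ k = -1 := by
    rw [← pow_add]
    exact Odd.neg_one_pow ⟨k, by ring⟩
  rw [hsign, neg_one_smul] at key
  rw [two_smul]
  nth_rewrite 2 [key]
  exact add_neg_cancel S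

/-- **(T2) for the semiregularity components**: `2 · σ_k(x ∘ x) = 0` for all `x ∈ Ext¹(F,F)` and all
`k` — the semiregularity map kills the doubles of all primary obstructions, in any characteristic
(Buchweitz–Flenner Cor. 4.8, there over `ℂ`). [cite: BuchweitzFlenner2003, Cor. 4.8] -/
theorem two_smul_semiregularityComponent_sq (hC : HasCentralAtiyah A) (hT : HasCyclicTrace A)
    (k : ℕ) (x : A.Ext 1 0) :
    (2 : 𝕜) • A.semiregularityComponent k (A.mul (rfl : 1 + 1 = 2) (rfl : 0 + 0 = 0) x x) = 0 := by
  rw [AtiyahTraceAlgebra.semiregularityComponent_apply, smul_comm,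
    two_smul_trace_sq_mul_atiyahPow hC hT, smul_zero]

/-- **(T2) when `2` is invertible** (e.g. `𝕜 = W_n(k)`, `p` odd — the crux has `p ≥ 7`):
`σ_k(x ∘ x) = 0`. So for two vector-bundle lifts `F`, `F + e` of the same bundle across a square-zero
step of the p-adic tower, `σ_k(o(F + e)) − σ_k(o(F)) = σ_k(β(e))` EXACTLY (the quadratic term of the
lift-change formula dies under `σ`): P1b♮'s left side is lift-independent up to a Bockstein image.
[cite: BuchweitzFlenner2003, Cor. 4.8] -/
theorem semiregularityComponent_sq_eq_zero [Invertible (2 : 𝕜)] (hC : HasCentralAtiyah A)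
    (hT : HasCyclicTrace A) (k : ℕ) (x : A.Ext 1 0) :
    A.semiregularityComponent k (A.mul (rfl : 1 + 1 = 2) (rfl : 0 + 0 = 0) x x) = 0 := by
  have h := two_smul_semiregularityComponent_sq hC hT k x
  calc A.semiregularityComponent k (A.mul (rfl : 1 + 1 = 2) (rfl : 0 + 0 = 0) x x)
      = (⅟(2 : 𝕜) * 2) •
          A.semiregularityComponent k (A.mul (rfl : 1 + 1 = 2) (rfl : 0 + 0 = 0) x x) := by
        rw [invOf_mul_self, one_smul]
    _ = 0 := by rw [← smul_smul, h, smul_zero]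

/-- **The whole p-adic Buchweitz–Flenner map kills primary obstructions** (`2` invertible):
`σ(x ∘ x) = 0` in `∏_k H^{k+2}(X, Ω^k)`. In particular a p-adically semiregular `E₁` has NO primary
obstructions at all (`x ∘ x = 0` for every `x ∈ Ext¹(E₁,E₁)`): its equal-characteristic deformations
are unobstructed to second order — a necessary condition for seeds that costs nothing, recorded for
P2a. [cite: BuchweitzFlenner2003, Cor. 4.8] -/
theorem semiregularityMap_sq_eq_zero [Invertible (2 : 𝕜)] (hC : HasCentralAtiyah A)
    (hT : HasCyclicTrace A) (x : A.Ext 1 0) :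
    A.semiregularityMap (A.mul (rfl : 1 + 1 = 2) (rfl : 0 + 0 = 0) x x) = 0 := by
  funext k
  rw [AtiyahTraceAlgebra.semiregularityMap_apply, semiregularityComponent_sq_eq_zero hC hT]
  rfl

/-- Corollary for SEMIREGULAR `F` (2 invertible): every `x ∈ Ext¹(F,F)` has `x ∘ x = 0` — the
Yoneda square vanishes identically on `Ext¹` of a p-adically semiregular bundle. (Converse direction of
use: a candidate seed with some `x ∘ x ≠ 0` is NOT semiregular — a one-line non-semiregularity test
that needs no knowledge of `σ`.) [cite: BuchweitzFlenner2003, Cor. 4.8] -/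
theorem sq_eq_zero_of_isSemiregular [Invertible (2 : 𝕜)] (hC : HasCentralAtiyah A)
    (hT : HasCyclicTrace A) (hσ : A.IsSemiregular) (x : A.Ext 1 0) :
    A.mul (rfl : 1 + 1 = 2) (rfl : 0 + 0 = 0) x x = 0 :=
  hσ (by rw [semiregularityMap_sq_eq_zero hC hT, map_zero])

end TorsorTest

/-! ## §7  Cycle 2 — the engine in its UNCONDITIONAL shape, audited; where each hypothesis enters

RECOMMENDED RESTATEMENT OF P1b (for the planner; content = the cards' P1b♮ / (i″), made
unconditional). For `𝒳/W` smooth proper, `p` odd, `1 ≤ r < p`, `n ≥ 1`, and EVERY finite locally free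
`E_n` on `X_n` with `E_n|X₁ ≅ E₁`:
  (β_n)  `π_{n+1}(ch_r^cris(E₁)) = p^n_* ( ι ( ε_r · σ_{r-1}(o(E_n; X_{n+1})) ) )`  in `H^{2r}(X_{n+1}, Ω^{<r}_{X_{n+1}/W_{n+1}})`,
where `π_{n+1} : H^{2r}_cris(X₁/W_{n+1}) = H^{2r}_dR(X_{n+1}/W_{n+1}) → H^{2r}(X_{n+1}, Ω^{<r})` is
reduction modulo `F^r` (the Hodge DEFECT, canonical, no torsion hypothesis), `ι : H^{r+1}(X₁,Ω^{r-1}) →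
H^{2r}(X₁, Ω^{<r}_{X₁})` the last-column map, `p^n_* : H^{2r}(X₁,Ω^{<r}_{X₁}) → H^{2r}(X_{n+1},Ω^{<r}_{X_{n+1}})`
induced by `Ω^{<r}_{X₁} ≅ p^nΩ^{<r}_{X_{n+1}} ⊂ Ω^{<r}_{X_{n+1}}`, `ε_r = ±1` a universal sign. No `K₀`,
no class obstruction, no `H_tf`, no `p > d + 6`, no projectivity; both sides are functions of the pair
(`X_{n+1} ⊃ X_n`, `E_n`). USE (`liftsStep_of_padicBlochIdentity`): BEK Hodge condition (rational) +
`H_tf` ⇒ `π_{n+1}(ch_r^cris E₁) = 0` (saturation of `F^r H_dR(𝒳/W)` in the torsion-free lattice);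
`H_tf` + Deligne–Illusie (`d < p`) ⇒ `p^n_* ∘ ι` injective; p-adic semiregularity ⇒ `o(E_n) = 0`. Hence
"semiregular + Hodge + `H_tf` ⇒ `LiftsFormally`" by induction on `n` with ANY choice of lifts and
`p > d` — the typed sibling crux P1a (`FormalLiftingFromClassLifting`) and Finding 1's (⋆) both become
unnecessary for the route (they remain true).

AUDIT OF THE PROOF SKETCH (card `cartan-classifying-map`, with `absolute-atiyah-window-collapse` as
the intrinsic twin) — this seat looked for the step that fails p-adically and found none:
(1) `ch^cris(E₁) = f₁^{*,cris} ch^dR(𝒬)` for a classifying map `f_n : X_n → G = Grass_W` of `E_n(m)`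
(crystalline Chern classes are functorial; on the smooth `W`-scheme `G` crystalline = de Rham,
compatibly with Chern classes of the universal quotient — Berthelot–Illusie); projectivity is used only
to globally generate `E_n(m)`: replaceable by local frames and the simplicial `BGL_r` (BEK §9), so
"projective → proper" survives as a mutation. (2) `f₁^*` on `H_dR(G_{n+1}) → H_dR(X_{n+1})` is computed
by ANY local lifts `f̃_α : U_{α,n+1} → G` and the HPD/Taylor homotopies of their differences
(Berthelot–Ogus §7); choosing `f̃_α ⊇ f_n|U_α` (exists: `G/W` smooth, `U_α` affine) makes all
differences `p^n θ_{αβ}`, `θ` a 1-cocycle of `f₁^*T_G`. (3) Taylor: `f̃_β^* − f̃_α^* = Σ_{|J|≥1}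
(δ^J/J!) ∂_J`, `δ ∈ p^n𝒪`; `v_p(p^{n|J|}/J!) ≥ n|J| − (|J|−1)/(p−1) ≥ n + 1` for `|J| ≥ 2`, `n ≥ 1`, `p`
odd — PROVED below in general (`dividedPowerWindowCollapse`, = ideator-1's typed stub; fails at `p = 2`); so mod
`p^{n+1}` only the Cartan term `p^n L_θ = p^n(dι_θ + ι_θ d)` survives, and secondary homotopies on
triple overlaps are `O(p^{2n}) = 0`. (4) Hence the Čech–de Rham cocycle of `f₁^{*,cris}c` (`c ∈ F^r`
representing `ch_r(𝒬)`) is `(f̃_α^* c) + p^n ι_θ c^{(r)}`; the first summand has form degrees `≥ r`, the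
second lies in `C^{r+1}(p^nΩ^{r-1})`, and its total differential `p^n dι_θ c^{(r)} ∈ C^{r+1}(Ω^r) ⊂ F^r`,
so MODULO `F^r` it is a cocycle of `Ω^{<r}` (where `d : Ω^{r-1} → Ω^r` is cut off): `π_{n+1}(ch_r^cris) =
p^n_*(ι[ι_θ f₁^*c^{(r)}])` with `[c^{(r)}] = gr^r_F ch_r(𝒬) = tr(At(𝒬)^r)/r!` (sign conventions aside).
This is also where TRANSVERSALITY (refuter defect D2, the cards' "window collapse") comes from: `ι_θ`
lowers the form degree by exactly one. (5) `θ ⌟ tr(At^r)/r! = tr((θ ⌟ At) At^{r-1})/(r−1)!` (`ι_θ` is a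
derivation, the trace is cyclic — the same two facts as §6) and `θ ⌟ f₁^*At(𝒬) = o(E_n(m); X_{n+1})`
(the gluing discrepancy of the local lifts `f̃_α^*𝒬` is the contraction of the map-difference with the
Atiyah class); untwisting by the liftable `𝒪(m)` is a Vandermonde in `m` with differences `< p`.
(6) Consistency checks all pass: rank one = Berthelot–Ogus 3.8 level by level; sums of line bundles =
Leibniz; Frobenius pull-backs: `σ_{≥1} = 0` (§4) and `φ(ch_r) = p^r F(ch_r)` (Gros: crystalline Chern
classes lie in the Nygaard/Mazur piece `M^r`), so both sides vanish for `r ≥ 2`; first step `n = 1`: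
transversality is Bloch–Esnault–Kerz's refined class `c(ξ) ∈ H^{2r}(p(r)Ω^•_{X₂})` with `p(r)Ω^j_{X₂} =
p^{r-j}Ω^j_{X₂} = 0` for `j ≤ r − 2` (arXiv:1203.2776 Def. 33, read p. 14); change of thickening
`X_{n+1} ↦ X_{n+1} + κ`: both sides move by `ι(κ ⌟ ch_r(E₁))` (card thickening-torsor; Bloch/BF's
`σ_{r-1}(κ ∪ At) = κ ⌟ ch_r`, a derivation count, no factor mismatch); torsor test: §6.
VERDICT OF THIS SEAT: (β_n) is a theorem-in-waiting, not a conjecture this seat can break; the crux as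
FILED should be demoted/restated — CLAIM (ii′) is Finding 1's theorem, CLAIM (i′) (level-wise K-theoretic
class obstruction, "gr^q component") is ill-posed as filed for `n ≥ 2` (D1/D2, §2) and, once well-posed in
relative `TC` (card dgm-syntomic-receptacle), a trace-methods compatibility that NO item of the route
consumes. -/

section EngineShape

/-- **Logical skeleton of the use of (β_n)** — which injectivity is which hypothesis:
`σ` injective = p-adic semiregularity of `E₁`; `ι` injective = Deligne–Illusie degeneration of the
bête-truncated Hodge–de Rham sequence of `X₁` (`d < p`, `W₂`-liftable; passes to `Ω^{<r}` because the
morphism of spectral sequences from `Ω^•` is an isomorphism on the columns `< r`); `pn` injective =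
no Bockstein = `H^{2r-1}(X_{n+1},Ω^{<r}) ↠ H^{2r-1}(X_n,Ω^{<r})` = Hodge-torsion-freeness of `𝒳/W` (with
degeneration over `W`); `π ch = 0` = BEK Hodge condition read integrally (saturation, `H_tf` again).
Conclusion: the obstruction of THIS lift vanishes. [folklore] -/
theorem liftsStep_of_padicBlochIdentity {E H Q₁ Q D : Type*} [AddCommGroup E] [AddCommGroup H]
    [AddCommGroup Q₁] [AddCommGroup Q] [AddCommGroup D] (σ : E →+ H) (ι : H →+ Q₁) (pn : Q₁ →+ Q)
    (π : D →+ Q) (ε : ℤˣ) (ch : D) (o : E)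
    (identity : π ch = pn (ι (ε • σ o)))
    (hHodge : π ch = 0) (hσ : Function.Injective σ) (hι : Function.Injective ι)
    (hpn : Function.Injective pn) : o = 0 := by
  rw [hHodge, eq_comm] at identity
  have h1 : ι (ε • σ o) = 0 := hpn (by rw [identity, map_zero])
  have h2 : ε • σ o = 0 := hι (by rw [h1, map_zero])
  have h3 : σ o = 0 := by rw [← inv_smul_smul ε (σ o), h2, smul_zero]
  exact hσ (by rw [h3, map_zero])

/-- **`H_tf` is load-bearing for any NORMALISED restatement** ("any proof must use `H_tf`"): drop
the injectivity of `pn` (a Bockstein in `H^*(𝒳, Ω^{<r})`, i.e. Hodge torsion) and the skeleton no longer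
forces `o = 0` — model `pn = 0`, `π = 0`, `σ = ι = id`, `o = 1`. GEOMETRIC INSTANCES on the Godeaux–Serre
model `𝒳/W` of refuter rattack-1498-0 (ledger negatives HodgeConjecture; `H²(𝒳,𝒪)_tors ≅ k`,
`H¹(𝒳,𝒪) = 0`, so `H¹(X_n,𝒪) ≅ H²(𝒳,𝒪)[p^n]` and the transition `H¹(X₂,𝒪) → H¹(X₁,𝒪)` is multiplication
by `p` on `H²(𝒳,𝒪)[p²] = H²(𝒳,𝒪)[p]`, i.e. ZERO: the Bockstein `β : H¹(X₁,𝒪) → H²(X₁,𝒪)` is injective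
on `H¹(X₁,𝒪) ≅ k ≠ 0`). (i) `r = 1`, level `n = 2`, `E₁ = 𝒪_{X₁}` (semiregular), two lifts to `X₂`:
`𝒪_{X₂}` (unobstructed) and `M_a`, `0 ≠ a ∈ H¹(X₁,𝒪)`, with `o(M_a) = β(a) ≠ 0` (§6 lift-change formula
in rank one) — so the NORMALISED identity "`o(L₂) = δ₃(c₁^cris L₁)` read in `H²(X₁,𝒪) ⊗ k`" is
lift-dependent, hence false, while (β₂) holds for both lifts (`π₃(c₁^cris 𝒪) = 0 = p²_* β(a)`): this is
the `pn`-injectivity failure modelled here. (ii) `r = 1`, `n = 1`, the witness `L₁` itself (`L₁^p`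
lifts, `L₁` does not): there it is the SATURATION step `π ch = 0` that fails — `c₁^cris(L₁)` is
rationally in `F¹` but `π₂(c₁^cris L₁) = p_* o(L₁) ≠ 0` is a torsion defect invisible to the rational BEK
Hodge condition (Berthelot–Ogus 3.8: `π₂ = 0 ⟺ L₁` lifts). Both failures are excluded by `H_tf`, and by
nothing weaker that this seat can name. [folklore] -/
theorem not_liftsStep_without_pnInjective :
    ¬ ∀ (E H Q₁ Q D : Type) [AddCommGroup E] [AddCommGroup H] [AddCommGroup Q₁] [AddCommGroup Q]
        [AddCommGroup D] (σ : E →+ H) (ι : H →+ Q₁) (pn : Q₁ →+ Q) (π : D →+ Q) (ε : ℤˣ) (ch : D)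
        (o : E), π ch = pn (ι (ε • σ o)) → π ch = 0 → Function.Injective σ →
        Function.Injective ι → o = 0 := by
  intro h
  have := h ℤ ℤ ℤ PUnit PUnit (AddMonoidHom.id ℤ) (AddMonoidHom.id ℤ) 0 0 1 PUnit.unit 1 rfl rfl
    (fun _ _ hab => hab) (fun _ _ hab => hab)
  exact one_ne_zero this

/-- **Deligne–Illusie is load-bearing** (drop `ι`-injectivity: this is §2's leak model in the present
skeleton) — model `ι = 0`. Geometrically irrelevant under the crux's `d + 6 < p` (degeneration holds), but
it records that a restatement over a NON-degenerating `X₁` (e.g. `d ≥ p`) is not claimed. [folklore] -/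
theorem not_liftsStep_without_iotaInjective :
    ¬ ∀ (E H Q₁ Q D : Type) [AddCommGroup E] [AddCommGroup H] [AddCommGroup Q₁] [AddCommGroup Q]
        [AddCommGroup D] (σ : E →+ H) (ι : H →+ Q₁) (pn : Q₁ →+ Q) (π : D →+ Q) (ε : ℤˣ) (ch : D)
        (o : E), π ch = pn (ι (ε • σ o)) → π ch = 0 → Function.Injective σ →
        Function.Injective pn → o = 0 := by
  intro h
  have := h ℤ ℤ ℤ ℤ PUnit (AddMonoidHom.id ℤ) 0 (AddMonoidHom.id ℤ) 0 1 PUnit.unit 1 rfl rfl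
    (fun _ _ hab => hab) (fun _ _ hab => hab)
  exact one_ne_zero this

/-- **The divided-power window collapses** (arithmetic heart of step (3) of the audit and of the
cards' transversality): `v_p(p^{nj}/j!) ≥ n + 1`, i.e. `n + 1 + v_p(j!) ≤ nj`, for every odd prime `p`,
`n ≥ 1`, `j ≥ 2`. This is VERBATIM the statement `IdeatorOne.DividedPowerWindowCollapse` typed —
unproved, one instance checked — in `IdeatorOneSketch.lean`; PROVED here in general from Legendre
(`(p − 1)·v_p(j!) < j`, Mathlib `sub_one_mul_padicValNat_factorial_lt_of_ne_zero`), so the lead may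
close that stub by `exact`. As disprover: there is NO arithmetic corner where a Taylor term of order
`≥ 2` survives modulo `p^{n+1}` for `p` odd. [folklore] -/
theorem dividedPowerWindowCollapse :
    ∀ (p : ℕ), p.Prime → p ≠ 2 → ∀ (n j : ℕ), 1 ≤ n → 2 ≤ j →
      n + 1 + padicValNat p j.factorial ≤ n * j := by
  intro p hp hp2 n j hn hj
  haveI := Fact.mk hp
  have hlt : (p - 1) * padicValNat p j.factorial < j :=
    sub_one_mul_padicValNat_factorial_lt_of_ne_zero p (by omega)
  have h2v : 2 * padicValNat p j.factorial ≤ (p - 1) * padicValNat p j.factorial :=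
    Nat.mul_le_mul_right _ (by have := hp.two_le; omega)
  have hA : n * (2 * padicValNat p j.factorial + 1) ≤ n * j := Nat.mul_le_mul_left n (by omega)
  have hB : padicValNat p j.factorial ≤ n * padicValNat p j.factorial :=
    Nat.le_mul_of_pos_left _ hn
  have hC : n * (2 * padicValNat p j.factorial + 1) = 2 * (n * padicValNat p j.factorial) + n := by
    ring
  have hD : n * 2 ≤ n * j := Nat.mul_le_mul_left n hj
  rw [hC] at hA
  omega

/-- … and it FAILS at `p = 2` (`n = 1`, `j = 2`: `v₂(2²/2!) = 1 < 2`): the one place where the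
mechanism predicts its own breakdown — outside the crux (`p ≥ 7`), recorded so that no restatement
silently admits `p = 2`. [folklore] -/
theorem dividedPowerWindow_fails_at_two :
    ¬ ((1 : ℕ) + 1 + padicValNat 2 (Nat.factorial 2) ≤ 1 * 2) := by
  have h2 : Nat.factorial 2 = 2 := by decide
  rw [h2, padicValNat.self (by norm_num)]
  omega

end EngineShape

/-! ## §8  Cycle 2 — one more refuted strengthening: RATIONAL level-wise class lifting is vacuous

STRENGTHENING S5 "(⋆)_ℚ": in the (⋆)-clause replace the integral hypothesis
`[F] ∈ im(K₀(X_{n+2}) → K₀(X_{n+1}))` by `[F] ⊗ 1 ∈ im(K₀(X_{n+2})_ℚ → K₀(X_{n+1})_ℚ)`, i.e.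
`∃ m, p^m[F] ∈ im`. This is FALSE, because the new hypothesis is ALWAYS satisfied:
`coker(K₀(X_{n+2}) → K₀(X_{n+1})) ↪ K₋₁(X_{n+2}, X_{n+1})`, the relative K-theory of a square-zero
ideal `J` with `pJ = 0`, which is p-primary torsion of bounded exponent (Weibel 1982, Mayer–Vietoris sequences and mod-p
K-theory: relative K-groups of a NILPOTENT ideal in a ring of characteristic `p^ν` are p-groups of bounded
exponent; alternatively (i) torsion by Goodwillie's rational theorem `K_*(A,J) ⊗ ℚ ≅ HC_{*-1}(A_ℚ, J_ℚ) = 0`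
as `A ⊗ ℚ = 0`, and (ii) uniquely `ℓ`-divisible for `ℓ ≠ p` by Gabber–Suslin rigidity for the henselian
pair, `ℓ ∈ 𝒪^×`); so `p^m[F]` lifts for EVERY `F`, and (⋆)_ℚ would say that every lift of a semiregular `E₁`
extends one more step — refuted by any NON-liftable line bundle (Berthelot–Ogus: `c₁^cris ∉ F¹` at level 2,
e.g. the graph class of a non-lifting endomorphism on `Ẽ × Ẽ`, cf. the sibling disproof of P1a).
Finding 1 explains the same thing from the σ side: `Σ_q` is `k`-linear, so `Σ_q(p[F]) = 0` carries no
information. CONSEQUENCE FOR THE ROUTE: level-wise, only INTEGRAL class statements have content; the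
rational improvements of BEK (Beilinson fibre square, AMMN 2022) cannot feed (⋆), and P1a's rational
PRO-class hypothesis acts only through the pro-structure (compatibility across all levels), never level
by level — consistent with the sibling seat's reduction of P1a to `IntegralStepClassLifting`. -/

section RationalVacuity

/-- **Model of S5's failure**: in `K = ℤ` with "restriction" `f = p · id` (image = `pℤ`, cokernel
`ℤ/p` = p-torsion, as for the K₀-tower), the element `x = 1` satisfies the RATIONAL lifting hypothesis
(`p¹ · 1 ∈ im f`) but not the integral one (`1 ∉ pℤ`). So "(∃ m y, f y = p^m x) → x ∈ im f" fails, and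
with it any (⋆)_ℚ. [folklore] -/
theorem not_star_rational (p : ℕ) (hp : 2 ≤ p) :
    ¬ ∀ x : ℤ, (∃ (m : ℕ) (y : ℤ), (p : ℤ) * y = (p : ℤ) ^ m * x) → ∃ y : ℤ, (p : ℤ) * y = x := by
  intro h
  obtain ⟨y, hy⟩ := h 1 ⟨1, 1, by ring⟩
  have hunit : IsUnit (p : ℤ) := IsUnit.of_mul_eq_one y hy
  rcases Int.isUnit_iff.1 hunit with h1 | h1 <;> omega

end RationalVacuity


/-! ## §9  Cycle 2 — scope of the verdict (what (β_n)/(ii′) do and do not cover) -/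

section Scope

/-- **Scope remarks** (no Lean content; recorded so that a restatement does not over- or under-claim).
(1) PERFECT COMPLEXES / W-FLAT COHERENT SHEAVES: both Finding 1 ((ii′), additivity of `σ∘ob` over
distinguished triangles of perfect complexes — trace additivity holds for maps of triangles that lift to
the dg-enhancement, which `ob` and `At` do, being natural transformations there) and (β_n) (Illusie's
`ob = e(X_{n+1}) ∪ At_{X_n/W}(E_n)` and BF Prop. 4.2 are statements about perfect complexes; the
Cartan computation runs on local free resolutions) extend verbatim; "`ob = 0 ⟺` a lift exists" holds
for complexes with negative self-Exts too (Lieblich 2006) — only UNIQUENESS of lifts becomes derived.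
So the crux's restriction to finite locally free `E₁` is caution, not necessity: NO KILL is available by
passing to complexes. (2) TWISTED SHEAVES (Brauer-twisted, e.g. Markman's secant sheaves, the likely
seeds of P2a): the OBJECT side is unchanged (`𝓔nd` is untwisted, `ob`, `At`, `σ_{q ≥ 1}` make sense) but
the CLASS side of (β_n) — `ch^cris` of a twisted sheaf — needs a crystalline B-field Chern character that
no item of the route defines; (β_n) as stated does not cover twisted seeds. This is a GAP BETWEEN ITEMS
(P1b untwisted/locally free vs. P2a's natural candidates), a route-level risk for the planner, not a
falsity of P1b. (3) PROPER vs PROJECTIVE: (β_n)'s proof sketch uses projectivity only to present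
`E_n(m)` as a Grassmannian pull-back; the intrinsic version (absolute Atiyah class, or the simplicial
classifying space `BGL_r` of Bloch–Esnault–Kerz §9) needs properness only (for finiteness and
Deligne–Illusie). (4) `p`: the identity needs `p` odd and `r < p` (`r!`, and `§7 dividedPowerWindow_fails_at_two`);
its USE needs `d < p` (degeneration) — the crux's `d + 6 < p` is Bloch–Esnault–Kerz's K-theoretic
constant and is not used by any step audited here. (5) WHAT WOULD STILL KILL THE LINE (for the next
re-arm): an explicit `(𝒳, E_n)` with `π_{n+1}(ch_r^cris E₁) ≠ p^n_* ι(±σ_{r-1}(o(E_n)))` — by §7 this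
requires a failure of the HPD/Taylor description of crystalline functoriality or of
`o(f^*𝒬) = θ ⌟ At(𝒬)`, both textbook; this seat rates it implausible and has no candidate. [folklore] -/
theorem scope_remarks_recorded : True := trivial

/-- **Mutation finding — the exact torsion hypothesis the engine's USE needs** (sharper than the crux's
"torsion-free Hodge cohomology `H^b(𝒳, Ω^a)` for all `a, b`"): for each weight `1 ≤ r ≤ d`, ONE group,
  (T_r)  `H^{2r}(𝒳, Ω^{<r}_{𝒳/W})` has no `p`-torsion
(cohomology of the bête-truncated de Rham complex of the `W`-model). (T_r) gives BOTH uses of `H_tf` in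
`liftsStep_of_padicBlochIdentity`: SATURATION (`ch_r^cris ∈ F^r` rationally ⇒ `π(ch_r^cris) = 0`: by
exactness of `H^{2r}(Ω^{≥r}) → H^{2r}_dR → H^{2r}(Ω^{<r})` the image of a rationally-Hodge class in
`H^{2r}(𝒳,Ω^{<r})` is torsion, hence `0`) and NO BOCKSTEIN (`p^n_*` injective on `H^{2r}(X₁, Ω^{<r})` ⟺
`H^{2r-1}(X_{n+1},Ω^{<r}) ↠ H^{2r-1}(X_n,Ω^{<r})`, which holds because base change gives
`H^{2r-1}(X_m, Ω^{<r}) = H^{2r-1}(𝒳,Ω^{<r})/p^m ⊕ H^{2r}(𝒳,Ω^{<r})[p^m]` and the second summand is `0`);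
`ι`-injectivity needs no torsion hypothesis (Deligne–Illusie on `X₁`, `d < p`). For `r = 1`, (T₁) is
"`H²(𝒳, 𝒪)` is `p`-torsion-free" — exactly Berthelot–Ogus's hypothesis and exactly what the Godeaux–Serre
witness violates. The crux's `H_tf` (all `a, b`) implies every (T_r) (degeneration over `W`), not
conversely; a planner restating P1b as (β_n) + use may carry `∧_{r ≤ d} (T_r)` instead. [folklore] -/
theorem minimal_torsion_hypothesis_recorded : True := trivial

end Scope

/-! ## §10  Cycle 3 (refuter-cdisprove-stmt-HodgeConjecture-13815-g3-0, 2026-08-16) — TARGETS: the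
stubs of the two registered skeletons (`Lines/sigma-ob-kzero-additivity.lean`: G / H / T;
`Lines/crystalline-abel-jacobi.lean`: `stub_firstStep` / `stub_deepSteps`). Junk-model audit (Findings
10–12 of the module docstring) and a kernel-checked REDUCTION of line B's ∃-stubs to line A's additivity
package. Nothing here imports a skeleton: statements are restated or copied verbatim. -/

section TargetsLineA

/-- **Stub G (`TowerStep`), affine model of the conormal identification — flatness is
load-bearing.** On an affine `Spec A ⊂ 𝒳`, the isomorphism `𝒪_𝒳/p ≅ p^{n+1}𝒪_𝒳/p^{n+2}𝒪_𝒳`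
(`a ↦ p^{n+1}a`) behind `conormalSheaf (X_{n+1} ↪ X_{n+2}) ≅ j_*𝒪_{X₁}` is INJECTIVE as soon as `A` has
no `p`-torsion (smooth ⇒ flat over `W` ⇒ `p`-torsion-free); surjectivity is tautological. [folklore] -/
theorem conormalStep_injective_of_torsionFree {A : Type*} [CommRing A] (p : A)
    (htf : ∀ a : A, p * a = 0 → a = 0) (n : ℕ) (a b : A)
    (h : p ^ (n + 1) * a = p ^ (n + 2) * b) : a = p * b := by
  have key : ∀ m : ℕ, ∀ c : A, p ^ m * c = 0 → c = 0 := by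
    intro m
    induction m with
    | zero => intro c hc; simpa using hc
    | succ m ih =>
      intro c hc
      apply ih
      apply htf
      rw [← mul_assoc, ← pow_succ']
      · exact hc
  have h' : p ^ (n + 1) * (a - p * b) = 0 := by
    rw [mul_sub, h, pow_succ, mul_assoc, sub_self]
  exact sub_eq_zero.mp (key (n + 1) (a - p * b) h')

/-- … and it FAILS without `p`-torsion-freeness: on the non-flat `W`-algebra `A = k` itself
(`𝒳 = Spec k`, `p = 0` in `A`) the map `a ↦ p^{n+1}a` kills `1 ∉ pA`. So a proof of stub G must
route through `SmoothOfRelativeDimension ⇒ Flat ⇒ Γ(U, 𝒪_𝒳)` `p`-torsion-free; no weaker reading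
of `IsSmoothProperModel` would do. Witness `A = ZMod 2`, `p = 2 = 0`, `a = 1`. [folklore] -/
theorem conormalStep_false_without_torsionFree :
    ¬ ∀ (A : Type) [CommRing A] (p : A) (n : ℕ) (a b : A),
        p ^ (n + 1) * a = p ^ (n + 2) * b → ∃ c : A, a = p * c := by
  intro h
  obtain ⟨c, hc⟩ := h (ZMod 2) 0 0 1 0 (by decide)
  rw [zero_mul] at hc
  exact one_ne_zero hc

open Literature.AlgebraicGeometry.HodgeTheory Literature.AlgebraicGeometry.Deformation
  Literature.AlgebraicGeometry.Modules

/-- **Stub T (`IsZeroOneSemiregularOfIso`), the trivial case `E = E'`**: nothing to prove (proof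
irrelevance for `hE`). So the WHOLE content of stub T is naturality of the real `σ₀ = Tr` and
`σ₁ = Tr(At ∘ −)` under a NON-identity isomorphism `e : E ≅ E'` — `SigmaObstructionNatural` below,
which implies T (`isZeroOneSemiregularOfIso_of_natural`). [folklore] -/
theorem isZeroOneSemiregular_of_eq {S : Type} [CommRing S] {Y : SchemeOver S}
    {E E' : Y.left.Modules} (h : E = E') (hE : IsFiniteLocallyFree E) (hE' : IsFiniteLocallyFree E') :
    IsZeroOneSemiregular hE → IsZeroOneSemiregular hE' := by
  subst h
  exact id

/-- **(T′) Naturality of the real semiregularity components under isomorphisms**, read on the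
obstruction groups: for `e : E ≅ E'` (finite locally free on an `S`-scheme `Y`) and
`x ∈ Ext²(E, E ⊗ 𝒪_Y)`, `σᵢ^{E'}(e x e⁻¹) = σᵢ^{E}(x)` (`i = 0, 1`; transport =
`Deformation.obstructionGroupCongr`). TRUE for the intended objects (conjugation invariance of the
trace; functoriality of Atiyah's jet sequence `P¹(E)` in `E`, Atiyah 1957 Prop. 6–7, which holds on the
nose for the tree's `JetSections`: `(s, φ) ↦ (e s, e ∘ φ)` is `𝒪`-linear for the twisted structures
because `δ(a, e s) = e δ(a, s)`), NOT yet proved in the tree (AtiyahClass.lean "Not here"); it is the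
exact residual content of stub T and it is ALSO what the reduction of line B below consumes.
[cite: Atiyah1957, Prop. 6–7] -/
def SigmaObstructionNatural : Prop :=
  ∀ (S : Type) [CommRing S] (Y : SchemeOver S) (E E' : Y.left.Modules) (e : E ≅ E')
    (hE : IsFiniteLocallyFree E) (hE' : IsFiniteLocallyFree E')
    (x : obstructionGroup 2 E (unitModule Y.left)),
    sigmaZeroObstruction hE' (obstructionGroupCongr 2 e (unitModule Y.left) x) =
        sigmaZeroObstruction hE x ∧
      sigmaOneObstruction hE' (obstructionGroupCongr 2 e (unitModule Y.left) x) =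
        sigmaOneObstruction hE x

/-- **(T′) ⇒ stub T** (`IsZeroOneSemiregularOfIso`, verbatim shape): naturality of `σ₀`, `σ₁` under
`e : E ≅ E'` transports `{0,1}`-semiregularity (read on the obstruction groups by
`isZeroOneSemiregular_iff_obstruction`). [folklore] -/
theorem isZeroOneSemiregularOfIso_of_natural (hN : SigmaObstructionNatural) :
    ∀ (S : Type) [CommRing S] (Y : SchemeOver S) (E E' : Y.left.Modules) (_e : E ≅ E')
      (hE : IsFiniteLocallyFree E) (hE' : IsFiniteLocallyFree E'),
      IsZeroOneSemiregular hE → IsZeroOneSemiregular hE' := by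
  intro S _ Y E E' e hE hE' hsr
  rw [isZeroOneSemiregular_iff_obstruction] at hsr ⊢
  intro o h0 h1
  set x := (obstructionGroupCongr 2 e (unitModule Y.left)).symm o with hx
  have ho : o = obstructionGroupCongr 2 e (unitModule Y.left) x := by
    rw [hx, AddEquiv.apply_symm_apply]
  rw [ho] at h0 h1
  rw [(hN S Y E E' e hE hE' x).1] at h0
  rw [(hN S Y E E' e hE hE' x).2] at h1
  have hx0 : x = 0 := hsr x h0 h1
  rw [ho, hx0, map_zero]

end TargetsLineA

/-! ### §10.2  Line B (`crystalline-abel-jacobi`): its ∃-stubs REDUCE to line A's additivity package -/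

section TargetsLineB

open Literature.AlgebraicGeometry.HodgeTheory Literature.AlgebraicGeometry.Deformation
  Literature.AlgebraicGeometry.Modules Literature.AlgebraicGeometry.Motives.WittScheme
open Limits

/-- Descending an additive map along a homomorphism onto its range, given that it kills the kernel
(first isomorphism theorem, written with `Classical.choose` to keep the bookkeeping elementary).
[folklore] -/
def descendToRange {G H A : Type*} [AddCommGroup G] [AddCommGroup H] [AddCommGroup A]
    (f : G →+ H) (Φ : G →+ A) (hΦ : ∀ z, f z = 0 → Φ z = 0) : f.range →+ A where
  toFun x := Φ (Classical.choose (AddMonoidHom.mem_range.mp x.2))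
  map_zero' := by
    apply hΦ
    have h := Classical.choose_spec (AddMonoidHom.mem_range.mp (0 : f.range).2)
    rw [h]
    rfl
  map_add' x y := by
    have hx := Classical.choose_spec (AddMonoidHom.mem_range.mp x.2)
    have hy := Classical.choose_spec (AddMonoidHom.mem_range.mp y.2)
    have hxy := Classical.choose_spec (AddMonoidHom.mem_range.mp (x + y).2)
    have h0 : f (Classical.choose (AddMonoidHom.mem_range.mp (x + y).2) -
        (Classical.choose (AddMonoidHom.mem_range.mp x.2) +
          Classical.choose (AddMonoidHom.mem_range.mp y.2))) = 0 := by
      rw [map_sub, map_add, hx, hy, hxy, AddSubgroup.coe_add, sub_self]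
    have h1 := hΦ _ h0
    rw [map_sub, map_add, sub_eq_zero] at h1
    exact h1

/-- `descendToRange f Φ _ (f z) = Φ z`. [folklore] -/
theorem descendToRange_apply {G H A : Type*} [AddCommGroup G] [AddCommGroup H] [AddCommGroup A]
    (f : G →+ H) (Φ : G →+ A) (hΦ : ∀ z, f z = 0 → Φ z = 0) (z : G) (x : f.range)
    (hx : (x : H) = f z) : descendToRange f Φ hΦ x = Φ z := by
  have h := Classical.choose_spec (AddMonoidHom.mem_range.mp x.2)
  have h0 : f (Classical.choose (AddMonoidHom.mem_range.mp x.2) - z) = 0 := by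
    rw [map_sub, h, hx, sub_self]
  have h1 := hΦ _ h0
  rw [map_sub, sub_eq_zero] at h1
  exact h1

variable {p : ℕ} [Fact p.Prime] {k : Type} [Field k] [CharP k p]

omit [Fact p.Prime] in
/-- `(W_{n+2} → W_{n+1} → k) = (W_{n+2} → k)` (copied from line B, `Lines/crystalline-abel-jacobi.lean`
§5, so that this work file does not import a skeleton). [folklore] -/
theorem wittQuotToResidue_comp_factor' [Fact p.Prime] (n : ℕ) :
    (wittQuotToResidue p k n).comp
        (Ideal.Quotient.factor (Ideal.pow_le_pow_right (Nat.le_succ (n + 1)))) =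
      wittQuotToResidue p k (n + 1) := by
  apply Ideal.Quotient.ringHom_ext
  ext x
  simp [wittQuotToResidue]

set_option backward.isDefEq.respectTransparency false in
/-- `X₁ ⟶ X_{n+1} ⟶ X_{n+2}` is `X₁ ⟶ X_{n+2}` (copied from line B §5). [folklore] -/
theorem specialFibreToThickening_comp_thickeningMap' (𝒳 : SchemeOver (WittVector p k)) (n : ℕ) :
    specialFibreToThickening 𝒳 n ≫ thickeningMap 𝒳 (Nat.le_succ (n + 1)) =
      specialFibreToThickening 𝒳 (n + 1) := by
  apply pullback.hom_ext
  · simp only [specialFibreToThickening, thickeningMap, Category.assoc, pullback.lift_fst,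
      Category.comp_id]
  · simp only [specialFibreToThickening, thickeningMap, Category.assoc, pullback.lift_snd,
      pullback.lift_snd_assoc]
    rw [← Spec.map_comp, ← CommRingCat.ofHom_comp, wittQuotToResidue_comp_factor']

/-- **`HasStepDatum` — VERBATIM COPY of line B's one-step output** (`Lines/crystalline-abel-jacobi.lean`
§2; its two registered stubs `stub_firstStep` / `stub_deepSteps` assert it for `n = 0` / `n ≥ 1` under
the setting `IsSmoothProperModel`, `IsProjectiveOverRing`, `p ≠ 2`, `d < p`, `H_tf`). Copied, not
imported, so that this work file stays independent of skeleton files. -/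
def HasStepDatum (𝒳 : SchemeOver (WittVector p k)) (E₁ : (specialFibre 𝒳).left.Modules)
    (hE₁ : IsFiniteLocallyFree E₁) (n : ℕ) : Prop :=
  ∃ (δ₀ : (KZero.map (specialFibreToThickening 𝒳 n)).range →+
        structureSheafCohomology (specialFibre 𝒳).left 2)
    (δ₁ : (KZero.map (specialFibreToThickening 𝒳 n)).range →+ hodgeCohomologyOne (specialFibre 𝒳) 3)
    (ob : ∀ (F : (WittScheme.thickening 𝒳 (n + 1)).left.Modules), IsFiniteLocallyFree F →
        ((Scheme.Modules.pullback (specialFibreToThickening 𝒳 n)).obj F ≅ E₁) →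
        obstructionGroup 2 E₁ (unitModule (specialFibre 𝒳).left))
    (ε₀ ε₁ : ℤˣ),
    (∀ x : (KZero.map (specialFibreToThickening 𝒳 n)).range,
      (∃ y : KZero (WittScheme.thickening 𝒳 (n + 2)).left,
        KZero.map (specialFibreToThickening 𝒳 (n + 1)) y = x.1) → δ₀ x = 0 ∧ δ₁ x = 0) ∧
    (∀ (F : (WittScheme.thickening 𝒳 (n + 1)).left.Modules) (hF : IsFiniteLocallyFree F)
        (α : (Scheme.Modules.pullback (specialFibreToThickening 𝒳 n)).obj F ≅ E₁),
      ob F hF α = 0 ↔ ∃ F' : (WittScheme.thickening 𝒳 (n + 2)).left.Modules, IsFiniteLocallyFree F' ∧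
        Nonempty ((Scheme.Modules.pullback (thickeningMap 𝒳 (Nat.le_succ (n + 1)))).obj F' ≅ F)) ∧
    (∀ (F : (WittScheme.thickening 𝒳 (n + 1)).left.Modules) (hF : IsFiniteLocallyFree F)
        (α : (Scheme.Modules.pullback (specialFibreToThickening 𝒳 n)).obj F ≅ E₁)
        (hx : KZero.of E₁ hE₁ ∈ (KZero.map (specialFibreToThickening 𝒳 n)).range),
      δ₀ ⟨KZero.of E₁ hE₁, hx⟩ = ε₀ • sigmaZeroObstruction hE₁ (ob F hF α) ∧
      δ₁ ⟨KZero.of E₁ hE₁, hx⟩ = ε₁ • sigmaOneObstruction hE₁ (ob F hF α))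

variable (𝒳 : SchemeOver (WittVector p k)) (n : ℕ)

/-- An obstruction map at the step `X_{n+1} ⊂ X_{n+2}` read on the special fibre — the TYPE of the
`Ob` produced by line A's stub H (`IllusieObstructionAdditive`) instantiated at
`(i, j) = (thickeningMap 𝒳 (n+1 ≤ n+2), specialFibreToThickening 𝒳 n)`. -/
abbrev StepOb : Type 1 :=
  ∀ (F : (WittScheme.thickening 𝒳 (n + 1)).left.Modules), IsFiniteLocallyFree F →
    obstructionGroup 2 ((Scheme.Modules.pullback (specialFibreToThickening 𝒳 n)).obj F)
      (unitModule (specialFibre 𝒳).left)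

variable {𝒳 n}

/-- (B) of line A's stub H at the step: `Ob F = 0` iff `F` extends to `X_{n+2}`. -/
def StepOb.LiftingCriterion (Ob : StepOb 𝒳 n) : Prop :=
  ∀ (F : (WittScheme.thickening 𝒳 (n + 1)).left.Modules) (hF : IsFiniteLocallyFree F),
    Ob F hF = 0 ↔ ∃ F' : (WittScheme.thickening 𝒳 (n + 2)).left.Modules, IsFiniteLocallyFree F' ∧
      Nonempty ((Scheme.Modules.pullback (thickeningMap 𝒳 (Nat.le_succ (n + 1)))).obj F' ≅ F)

/-- (A₀) of line A's stub H at the step: `σ₀ ∘ Ob` is additive on short exact sequences. -/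
def StepOb.AdditiveZero (Ob : StepOb 𝒳 n) : Prop :=
  ∀ (S : ShortComplex (WittScheme.thickening 𝒳 (n + 1)).left.Modules), S.ShortExact →
    ∀ (h₁ : IsFiniteLocallyFree S.X₁) (h₂ : IsFiniteLocallyFree S.X₂) (h₃ : IsFiniteLocallyFree S.X₃),
      sigmaZeroObstruction (h₂.pullback (specialFibreToThickening 𝒳 n)) (Ob S.X₂ h₂) =
        sigmaZeroObstruction (h₁.pullback (specialFibreToThickening 𝒳 n)) (Ob S.X₁ h₁) +
          sigmaZeroObstruction (h₃.pullback (specialFibreToThickening 𝒳 n)) (Ob S.X₃ h₃)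

/-- (A₁) of line A's stub H at the step: `σ₁ ∘ Ob` is additive on short exact sequences. -/
def StepOb.AdditiveOne (Ob : StepOb 𝒳 n) : Prop :=
  ∀ (S : ShortComplex (WittScheme.thickening 𝒳 (n + 1)).left.Modules), S.ShortExact →
    ∀ (h₁ : IsFiniteLocallyFree S.X₁) (h₂ : IsFiniteLocallyFree S.X₂) (h₃ : IsFiniteLocallyFree S.X₃),
      sigmaOneObstruction (h₂.pullback (specialFibreToThickening 𝒳 n)) (Ob S.X₂ h₂) =
        sigmaOneObstruction (h₁.pullback (specialFibreToThickening 𝒳 n)) (Ob S.X₁ h₁) +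
          sigmaOneObstruction (h₃.pullback (specialFibreToThickening 𝒳 n)) (Ob S.X₃ h₃)

/-- **Finding 1's generalised determinant `Σ₀ : K₀(X_{n+1}) →+ H²(X₁, 𝒪)`, now on REAL carriers**:
the `K₀`-factorisation (`KZero.lift`) of `F ↦ σ₀(Ob F)` (real `σ₀ = Tr` of the bridge file).
[folklore] -/
def StepOb.SigmaZero (Ob : StepOb 𝒳 n) (hA : Ob.AdditiveZero) :
    KZero (WittScheme.thickening 𝒳 (n + 1)).left →+ structureSheafCohomology (specialFibre 𝒳).left 2 :=
  KZero.lift (fun F hF => sigmaZeroObstruction (hF.pullback (specialFibreToThickening 𝒳 n)) (Ob F hF)) hA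

/-- `Σ₁ : K₀(X_{n+1}) →+ H³(X₁, Ω¹)`, the `K₀`-factorisation of `F ↦ σ₁(Ob F)`. [folklore] -/
def StepOb.SigmaOne (Ob : StepOb 𝒳 n) (hA : Ob.AdditiveOne) :
    KZero (WittScheme.thickening 𝒳 (n + 1)).left →+ hodgeCohomologyOne (specialFibre 𝒳) 3 :=
  KZero.lift (fun F hF => sigmaOneObstruction (hF.pullback (specialFibreToThickening 𝒳 n)) (Ob F hF)) hA

/-- `Σ₀[F] = σ₀(Ob F)`. [folklore] -/
theorem StepOb.SigmaZero_of (Ob : StepOb 𝒳 n) (hA : Ob.AdditiveZero)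
    (F : (WittScheme.thickening 𝒳 (n + 1)).left.Modules) (hF : IsFiniteLocallyFree F) :
    Ob.SigmaZero hA (KZero.of F hF) =
      sigmaZeroObstruction (hF.pullback (specialFibreToThickening 𝒳 n)) (Ob F hF) :=
  KZero.lift_of _ _ F hF

/-- `Σ₁[F] = σ₁(Ob F)`. [folklore] -/
theorem StepOb.SigmaOne_of (Ob : StepOb 𝒳 n) (hA : Ob.AdditiveOne)
    (F : (WittScheme.thickening 𝒳 (n + 1)).left.Modules) (hF : IsFiniteLocallyFree F) :
    Ob.SigmaOne hA (KZero.of F hF) =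
      sigmaOneObstruction (hF.pullback (specialFibreToThickening 𝒳 n)) (Ob F hF) :=
  KZero.lift_of _ _ F hF

/-- (B) ⇒ `Σ₀` kills every class restricted from `K₀(X_{n+2})` (Finding 1 (B)). [folklore] -/
theorem StepOb.SigmaZero_map (Ob : StepOb 𝒳 n) (hB : Ob.LiftingCriterion) (hA : Ob.AdditiveZero)
    (y : KZero (WittScheme.thickening 𝒳 (n + 2)).left) :
    Ob.SigmaZero hA (KZero.map (thickeningMap 𝒳 (Nat.le_succ (n + 1))) y) = 0 := by
  have hcomp : (Ob.SigmaZero hA).comp (KZero.map (thickeningMap 𝒳 (Nat.le_succ (n + 1)))) = 0 :=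
    KZero.hom_ext fun G hG => by
      rw [AddMonoidHom.comp_apply, KZero.map_of, StepOb.SigmaZero_of,
        (hB _ _).2 ⟨G, hG, ⟨Iso.refl _⟩⟩, map_zero, AddMonoidHom.zero_apply]
  have h := DFunLike.congr_fun hcomp y
  rwa [AddMonoidHom.comp_apply, AddMonoidHom.zero_apply] at h

/-- (B) ⇒ `Σ₁` kills every class restricted from `K₀(X_{n+2})`. [folklore] -/
theorem StepOb.SigmaOne_map (Ob : StepOb 𝒳 n) (hB : Ob.LiftingCriterion) (hA : Ob.AdditiveOne)
    (y : KZero (WittScheme.thickening 𝒳 (n + 2)).left) :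
    Ob.SigmaOne hA (KZero.map (thickeningMap 𝒳 (Nat.le_succ (n + 1))) y) = 0 := by
  have hcomp : (Ob.SigmaOne hA).comp (KZero.map (thickeningMap 𝒳 (Nat.le_succ (n + 1)))) = 0 :=
    KZero.hom_ext fun G hG => by
      rw [AddMonoidHom.comp_apply, KZero.map_of, StepOb.SigmaOne_of,
        (hB _ _).2 ⟨G, hG, ⟨Iso.refl _⟩⟩, map_zero, AddMonoidHom.zero_apply]
  have h := DFunLike.congr_fun hcomp y
  rwa [AddMonoidHom.comp_apply, AddMonoidHom.zero_apply] at h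

/-- **The `K`-theoretic lift-invariance condition** (where `H_tf` enters line B for `n ≥ 1`):
`Σ₀`, `Σ₁` kill `ker(K₀(X_{n+1}) → K₀(X₁))`, i.e. `σᵢ(Ob F)` depends only on the class of `F|X₁` in
`K₀(X₁)`. For `n = 0` the kernel is `0` (`X_k ⟶ X₁` is an isomorphism for `k` perfect:
`kZero_map_injective_of_isIso`); for `n ≥ 1` it contains the torsor differences `[F + e] − [F]`, on
which `Σ` is the Bockstein image `σ(β(e))` (Disproof §6 lift-change formula) — zero under `H_tf`,
NON-zero on the Godeaux–Serre model (§7 (i)). -/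
def StepOb.KernelVanishing (Ob : StepOb 𝒳 n) (hA₀ : Ob.AdditiveZero) (hA₁ : Ob.AdditiveOne) : Prop :=
  ∀ z : KZero (WittScheme.thickening 𝒳 (n + 1)).left,
    KZero.map (specialFibreToThickening 𝒳 n) z = 0 → Ob.SigmaZero hA₀ z = 0 ∧ Ob.SigmaOne hA₁ z = 0

/-- **REDUCTION THEOREM (cycle 3).** Line B's one-step ∃-datum `HasStepDatum 𝒳 E₁ hE₁ n` — the common
body of its registered stubs `stub_firstStep` (`n = 0`) and `stub_deepSteps` (`n ≥ 1`) — FOLLOWS, for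
every `𝒳` and every `E₁`, with NO torsion-freeness, NO projectivity, NO `p ≠ 2`, NO `d < p` and NO
crystalline Chern character, from: an obstruction map `Ob` at the step with line A's (B) and
additivity (A₀), (A₁) (= line A's stub H instantiated at the step, given line A's stub G), the
naturality (T′) of the real `σ₀`, `σ₁` under isomorphisms, and the kernel condition
`KernelVanishing` (automatic at `n = 0`). WITNESS: `δᵢ := Σᵢ` descended to
`im(K₀(X_{n+1}) → K₀(X₁))`, `ob F hF α := α_*(Ob F)`, `ε₀ = ε₁ = 1`.
CONSEQUENCES. (1) The ∃-typed stubs of line B do not mention `ch^cris`: read literally they assert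
only "an additive, lift-invariant extension of `σ ∘ ob` to `im(K₀(X_{n+1}) → K₀(X₁))` killing the
two-step-liftable classes" — which is Finding 1's `Σ`. The crystalline Abel–Jacobi IDENTITY
`δ = (p^{n+1}_* ι)^{-1} π_{n+2} ch_r^cris` lives only in the docstrings; a lead closing `stub_firstStep`
through this theorem proves nothing about (β_n)/(i′). (Planner: to make the identity load-bearing the
datum must pin `δ` to the real crystalline Chern character — a `CrystallineRealization`-relative
statement — or conclude something additivity cannot, e.g. step lifting WITHOUT the `K₀` hypothesis,
`HasHodgeStepDatum`.) (2) `stub_firstStep` needs none of `H_tf`, `IsProjectiveOverRing`, `p ≠ 2`,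
`d < p` (hypothesis mutation: all four are decoration THERE). (3) `stub_deepSteps` = additivity +
`KernelVanishing`; the latter is where `H_tf` is genuinely load-bearing
(`exists_liftInvariant_of_hasStepDatum` + the Godeaux–Serre witness: FALSE without `H_tf` at `n = 1`,
`E₁ = 𝒪`). [folklore] -/
theorem hasStepDatum_of_additivePackage (Ob : StepOb 𝒳 n) (hB : Ob.LiftingCriterion)
    (hA₀ : Ob.AdditiveZero) (hA₁ : Ob.AdditiveOne) (hN : SigmaObstructionNatural)
    (hker : Ob.KernelVanishing hA₀ hA₁) (E₁ : (specialFibre 𝒳).left.Modules)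
    (hE₁ : IsFiniteLocallyFree E₁) : HasStepDatum 𝒳 E₁ hE₁ n := by
  refine ⟨descendToRange _ (Ob.SigmaZero hA₀) (fun z hz => (hker z hz).1),
    descendToRange _ (Ob.SigmaOne hA₁) (fun z hz => (hker z hz).2),
    fun F hF α => obstructionGroupCongr 2 α (unitModule (specialFibre 𝒳).left) (Ob F hF), 1, 1,
    ?_, ?_, ?_⟩
  · -- (V): classes restricted from `K₀(X_{n+2})` are killed
    rintro x ⟨y, hy⟩
    have hx : (x : KZero (specialFibre 𝒳).left) =
        KZero.map (specialFibreToThickening 𝒳 n) (KZero.map (thickeningMap 𝒳 (Nat.le_succ (n + 1))) y) := by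
      rw [← KZero.map_comp_apply, specialFibreToThickening_comp_thickeningMap', hy]
    refine ⟨?_, ?_⟩
    · rw [descendToRange_apply _ _ _ _ x hx]
      exact Ob.SigmaZero_map hB hA₀ y
    · rw [descendToRange_apply _ _ _ _ x hx]
      exact Ob.SigmaOne_map hB hA₁ y
  · -- (OB): the transported obstruction vanishes iff `F` extends
    intro F hF α
    rw [AddEquiv.map_eq_zero_iff]
    exact hB F hF
  · -- (ID): `δᵢ[E₁] = σᵢ(ob F)` for every lift, by `Σᵢ[F] = σᵢ(Ob F)` and naturality (T′)
    intro F hF α hx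
    have hcls : (KZero.of E₁ hE₁ : KZero (specialFibre 𝒳).left) =
        KZero.map (specialFibreToThickening 𝒳 n) (KZero.of F hF) := by
      rw [KZero.map_of]
      exact (KZero.of_iso α _ _).symm
    obtain ⟨hN0, hN1⟩ := hN k (specialFibre 𝒳) _ E₁ α (hF.pullback (specialFibreToThickening 𝒳 n)) hE₁
      (Ob F hF)
    refine ⟨?_, ?_⟩
    · rw [descendToRange_apply _ _ _ (KZero.of F hF) _ hcls, StepOb.SigmaZero_of, one_smul, hN0]
    · rw [descendToRange_apply _ _ _ (KZero.of F hF) _ hcls, StepOb.SigmaOne_of, one_smul, hN1]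

/-- `K₀`-pull-back along an isomorphism of schemes is injective (functor laws of `KZero.map`). Used:
at `n = 0`, `X_k ⟶ X₁` is an isomorphism (`W(k)/p = k`, `k` perfect), so `KernelVanishing` is
automatic and `stub_firstStep` is literally a corollary of line A. [folklore] -/
theorem kZero_map_injective_of_isIso {Y Z : Scheme.{u}} (f : Y ⟶ Z) [IsIso f] :
    Function.Injective (KZero.map f) := by
  intro a b h
  have key : ∀ x : KZero Z, KZero.map (inv f) (KZero.map f x) = x := fun x => by
    rw [← KZero.map_comp_apply, IsIso.inv_hom_id, KZero.map_id, AddMonoidHom.id_apply]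
  rw [← key a, ← key b, h]

/-- `KernelVanishing` is automatic when `X_k ⟶ X_{n+1}` induces an injection on `K₀` — the case
`n = 0`. [folklore] -/
theorem StepOb.kernelVanishing_of_injective (Ob : StepOb 𝒳 n) (hA₀ : Ob.AdditiveZero)
    (hA₁ : Ob.AdditiveOne)
    (hinj : Function.Injective (KZero.map (specialFibreToThickening 𝒳 n))) :
    Ob.KernelVanishing hA₀ hA₁ := by
  intro z hz
  have hz0 : z = 0 := hinj (by rw [hz, map_zero])
  rw [hz0, map_zero, map_zero]
  exact ⟨rfl, rfl⟩

section PerfectResidue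

variable [PerfectRing k p]

omit 𝒳 n in
/-- **`W(k)/p = k` for `k` perfect**: the residue map `wittQuotToResidue p k 0 : W(k)/p¹ → k` is
bijective (injective: `x₀ = 0 ⇒ x = V(x') = V(F y) = p y`, Mathlib `eq_iterate_verschiebung`,
`frobenius_bijective`, `verschiebung_frobenius`; surjective: Teichmüller). [folklore] -/
theorem wittQuotToResidue_zero_bijective : Function.Bijective (wittQuotToResidue p k 0) := by
  constructor
  · rw [injective_iff_map_eq_zero]
    intro x hx
    obtain ⟨x, rfl⟩ := Ideal.Quotient.mk_surjective x
    have hx0 : WittVector.constantCoeff x = 0 := by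
      simpa [wittQuotToResidue] using hx
    rw [Ideal.Quotient.eq_zero_iff_mem, pow_one]
    have h1 : x = WittVector.verschiebung (x.shift 1) := by
      have h := WittVector.eq_iterate_verschiebung (x := x) (n := 1) (fun i hi => by
        have hi0 : i = 0 := by omega
        subst hi0
        rwa [WittVector.constantCoeff_apply] at hx0)
      simpa using h
    obtain ⟨y, hy⟩ := (WittVector.frobenius_bijective p k).2 (x.shift 1)
    rw [h1, ← hy, WittVector.verschiebung_frobenius]
    exact Ideal.mul_mem_left _ _ (Ideal.subset_span rfl)
  · intro a
    refine ⟨Ideal.Quotient.mk _ (WittVector.teichmuller p a), ?_⟩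
    simp [wittQuotToResidue, WittVector.constantCoeff_apply, WittVector.teichmuller_coeff_zero]

omit 𝒳 n in
/-- `Spec k → Spec W(k)/p` is an isomorphism of affine schemes (`k` perfect). [folklore] -/
theorem isIso_ofHom_wittQuotToResidue_zero :
    IsIso (CommRingCat.ofHom (wittQuotToResidue p k 0)) := by
  have h : CommRingCat.ofHom (wittQuotToResidue p k 0) =
      (RingEquiv.ofBijective _
        (wittQuotToResidue_zero_bijective (p := p) (k := k))).toCommRingCatIso.hom := rfl
  rw [h]
  infer_instance

omit n in
/-- **`X_k ⟶ X₁` is an isomorphism** for `k` perfect (`X₁ = 𝒳 ⊗ W/p = 𝒳 ⊗ k`): the first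
inclusion of the `p`-adic tower, `specialFibreToThickening 𝒳 0`, is `IsIso`. Hence
`K₀(X₁) → K₀(X_k)` is injective and `KernelVanishing` holds at `n = 0` for every obstruction map.
[folklore] -/
instance isIso_specialFibreToThickening_zero : IsIso (specialFibreToThickening 𝒳 0) := by
  haveI := isIso_ofHom_wittQuotToResidue_zero (p := p) (k := k)
  dsimp only [specialFibreToThickening]
  exact pullback.map_isIso _ _ _ _ _ _ _ _ _

/-- **`stub_firstStep` ⟸ line A, unconditionally in the setting**: at `n = 0` the ∃-datum follows from
an obstruction map with (B), (A₀), (A₁) and the naturality (T′) ALONE — no `H_tf`, no projectivity,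
no `p ≠ 2`, no `d < p`, no smoothness even (those enter line A's stub G only to PRODUCE `Ob`).
[folklore] -/
theorem hasStepDatum_zero_of_additivePackage (Ob : StepOb 𝒳 0) (hB : Ob.LiftingCriterion)
    (hA₀ : Ob.AdditiveZero) (hA₁ : Ob.AdditiveOne) (hN : SigmaObstructionNatural)
    (E₁ : (specialFibre 𝒳).left.Modules) (hE₁ : IsFiniteLocallyFree E₁) : HasStepDatum 𝒳 E₁ hE₁ 0 :=
  hasStepDatum_of_additivePackage Ob hB hA₀ hA₁ hN
    (Ob.kernelVanishing_of_injective hA₀ hA₁ (kZero_map_injective_of_isIso _)) E₁ hE₁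

end PerfectResidue

/-- **The real shadow of line B's datum: lift-INVARIANCE of `σ ∘ ob`.** Any datum forces
`σᵢ(ob F hF α)` to be the same for ALL finite locally free lifts `(F, α)` of `E₁` to `X_{n+1}`
(both equal `εᵢ⁻¹ δᵢ[E₁]`). GEOMETRIC CONSEQUENCE (the `H_tf`-test of `stub_deepSteps`): on the
Godeaux–Serre model of refuter rattack-1498-0 (`H²(𝒳,𝒪)[p] ≠ 0`, Bockstein
`β : H¹(X₁,𝒪) ≅ k → H²(X₁,𝒪)` injective), take `n = 1`, `E₁ = 𝒪_{X₁}` (semiregular), and the two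
lifts `𝒪_{X₂}` (extends to `X₃`) and `M_a = 1 + pã`, `a ≠ 0` (does not: `o(M_a; X₃) = β(a) ≠ 0`, §6);
any `ob` with the lifting criterion has `ob(𝒪_{X₂}) = 0 ≠ ob(M_a)`, and in rank one `σ₀ = Tr` is
injective, so `σ₀ ∘ ob` is NOT lift-invariant: NO datum exists at `n = 1` there. Hence
`stub_deepSteps` is FALSE without `H_tf` (any proof must use it), whereas at `n = 0` lifts are unique
up to isomorphism and `stub_firstStep` survives the removal of `H_tf` (cf. the reduction theorem).
[folklore] -/
theorem exists_liftInvariant_of_hasStepDatum {E₁ : (specialFibre 𝒳).left.Modules}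
    {hE₁ : IsFiniteLocallyFree E₁} (h : HasStepDatum 𝒳 E₁ hE₁ n) :
    ∃ ob : ∀ (F : (WittScheme.thickening 𝒳 (n + 1)).left.Modules), IsFiniteLocallyFree F →
        ((Scheme.Modules.pullback (specialFibreToThickening 𝒳 n)).obj F ≅ E₁) →
        obstructionGroup 2 E₁ (unitModule (specialFibre 𝒳).left),
      (∀ (F : (WittScheme.thickening 𝒳 (n + 1)).left.Modules) (hF : IsFiniteLocallyFree F)
          (α : (Scheme.Modules.pullback (specialFibreToThickening 𝒳 n)).obj F ≅ E₁),
        ob F hF α = 0 ↔ ∃ F' : (WittScheme.thickening 𝒳 (n + 2)).left.Modules, IsFiniteLocallyFree F' ∧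
          Nonempty ((Scheme.Modules.pullback (thickeningMap 𝒳 (Nat.le_succ (n + 1)))).obj F' ≅ F)) ∧
      ∀ (F F' : (WittScheme.thickening 𝒳 (n + 1)).left.Modules) (hF : IsFiniteLocallyFree F)
        (hF' : IsFiniteLocallyFree F')
        (α : (Scheme.Modules.pullback (specialFibreToThickening 𝒳 n)).obj F ≅ E₁)
        (α' : (Scheme.Modules.pullback (specialFibreToThickening 𝒳 n)).obj F' ≅ E₁),
        sigmaZeroObstruction hE₁ (ob F hF α) = sigmaZeroObstruction hE₁ (ob F' hF' α') ∧
          sigmaOneObstruction hE₁ (ob F hF α) = sigmaOneObstruction hE₁ (ob F' hF' α') := by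
  obtain ⟨δ₀, δ₁, ob, ε₀, ε₁, -, hob, hid⟩ := h
  refine ⟨ob, hob, fun F F' hF hF' α α' => ?_⟩
  have hx : KZero.of E₁ hE₁ ∈ (KZero.map (specialFibreToThickening 𝒳 n)).range :=
    ⟨KZero.of F hF, by rw [KZero.map_of]; exact KZero.of_iso α _ _⟩
  obtain ⟨h0, h1⟩ := hid F hF α hx
  obtain ⟨h0', h1'⟩ := hid F' hF' α' hx
  refine ⟨?_, ?_⟩
  · exact MulAction.injective ε₀ (h0.symm.trans h0')
  · exact MulAction.injective ε₁ (h1.symm.trans h1')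

end TargetsLineB

/-! ## §11  Cycle 4 (refuter-cdisprove-stmt-HodgeConjecture-13815-g4-0, 2026-08-16) — thickening-equivariance
of (β₁), the Dwork–Ogus witness, characteristic-zero transfer

Landed copy (importable): `Theorems/PadicPridhamSemiregularity/Negative/ThickeningEquivariance.lean`.

### §11.1  The torsor of `W₂`-lifts acts on both sides of (β₁) compatibly

SETTING. `X₁/k` smooth proper, `k` perfect, `X₂` a `W₂`-lift, `H := H^{2r}_cris(X₁/W₂)` free over `W₂`
with `F^r_{X₂} := im H^{2r}(X₂, Ω^{≥r}) ⊂ H^{2r}_dR(X₂/W₂) = H` a direct summand and Hodge–de Rham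
degeneration for `X₁` (all implied by the crux's `H_tf` + `d < p`; only level 2 is used). Put `H̄ = H/p`,
`F̄ = F^r_{X₂}/p = F^r H^{2r}_dR(X₁)` (independent of `X₂`), `Q̄ := H̄/F̄^r = H^{2r}(X₁, Ω^{<r})`. For
`c ∈ H` with `c̄ ∈ F̄^r` the class `π_{X₂}(c) ∈ H/F^r_{X₂}` dies mod `p`, hence equals `p · q_{X₂}(c)` for a
unique `q_{X₂}(c) ∈ Q̄` (`pH ∩ F^r = pF^r`). The `W₂`-lifts of `X₁` form a torsor under `K := H¹(X₁, T)`.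
TRANSFORMATION RULES (textbook; the only inputs):
(T-ob)    `o(E₁; X₂ + κ) = o(E₁; X₂) + κ ⌟ At(E₁)` in `Ext²(E₁, E₁)` — Illusie, Complexe cotangent IV §3:
          the obstruction is the Yoneda product of the ABSOLUTE Atiyah class
          `At_{X₁/W}(E₁) ∈ Ext¹(E₁, E₁ ⊗ L_{X₁/W})` with the class of the extension; `L_{X₁/W} ≃ Ω¹_{X₁/k} ⊕
          𝒪_{X₁}[1]` NON-canonically, the splittings being exactly the `W₂`-lifts, and moving the splitting
          by `κ ∈ H¹(T) = Hom(Ω¹, 𝒪[1])` moves the `Ext²`-component by `κ ∘ At_{X₁/k}(E₁)` (this is the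
          "absolute Atiyah class" of card absolute-atiyah-window-collapse at level 2);
(T-Hodge) `q_{X₂+κ}(c) = q_{X₂}(c) − ι(κ ⌟ c̄^{(r,r)})` for `c̄ ∈ F̄^r`, `c̄^{(r,r)}` its `gr^r`-component,
          `ι : gr^{r−1}_F H̄ = H^{r+1}(X₁, Ω^{r−1}) ↪ Q̄` the inclusion `F̄^{r−1}/F̄^r ⊂ H̄/F̄^r` (injective
          by construction) — crystalline Kodaira–Spencer at level 2: inside `H`,
          `F^r_{X₂+κ} = (1 + pθ_κ)(F^r_{X₂})` with `θ_κ : H̄ → H̄` of filtration degree `−1` inducing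
          `κ ⌟` on the graded pieces (Griffiths transversality; Katz 1970, Berthelot–Ogus §3 for line
          bundles, Dwork–Ogus 1986 (2.4) proof "the map Def → L_cris is compatible with cup product"); proof
          of the rule: write `c = f + p n₁` (`f ∈ F^r_{X₂}`), then `c = (f + pθ_κ f̄) + p(n₁ − θ_κ f̄)` and
          `θ_κ f̄ mod F̄^r` is `κ ⌟ f̄^{(r,r)}`;
(BF)      `σ_{r−1}(κ ⌟ At(E₁)) = κ ⌟ ch_r(E₁)^{(r,r)}` (`ι_κ` is a derivation on `tr At^r/r!` and the
          trace is cyclic — Buchweitz–Flenner 2003 Prop. 3.12 / Cor. 4.8, characteristic-free with `r!`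
          invertible; the same two facts as §6);
(BI)      if `E₁` lifts to `E₂'` on `X₂' := X₂ + κ` then `ch_r^cris(E₁) ∈ F^r_{X₂'}`, i.e. `q_{X₂'} = 0`
          (Berthelot–Illusie 1970: crystalline Chern classes are computed by any lift).
CONSEQUENCES (kernel-checked skeleton below, `A κ := κ ⌟ At`, `B κ := ι(κ ⌟ ch_r^{(r,r)})`,
`S := ι ∘ σ_{r−1}`, `S ∘ A = B` by (BF)):
* `padicBloch_shift_iff`: "(β₁) with `ε = −1` at `X₂`" ⟺ "(β₁) with `ε = −1` at `X₂ + κ`";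
* `padicBloch_defect_shift_invariant`: `Δ_r(E₁) := q_{X₂}(ch_r^cris E₁) + S(o(E₁; X₂)) ∈ Q̄` does not
  depend on the lift `X₂` — a SECONDARY CLASS of `E₁` on the `W₂`-liftable `X₁`;
* `padicBloch_plus_sign_refuted`: the opposite sign cannot hold at two lifts differing by `κ` with
  `2Bκ ≠ 0` — the universal sign `ε_r` that §7 left open is FORCED (`ε = −1` in the conventions of the two
  rules; a convention change flips both rules together);
* `padicBloch_of_liftsSomewhere`: if `E₁` lifts to SOME `W₂`-lift of `X₁` then (β₁) holds at EVERY lift: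
  `q_{X₂}(ch_r^cris E₁) = −ι σ_{r−1}(o(E₁; X₂))`;
* by Finding 1 (A) both terms of `Δ_r` are additive over short exact sequences on `X₁`, so
  `Δ_r : K₀(X₁) → Q̄` is a homomorphism vanishing on `K₀^{lift}(X₁) := ⟨[E] : E lifts to some W₂-lift⟩`
  (`defect_eq_of_sub_mem`: (β₁) for `E₁` follows from (β₁) for any `E₁'` congruent mod `K₀^{lift}`);
* NATURALITY ⇒ VANISHING: the MAP versions of (T-ob)/(T-Hodge) — for `f : X₁ → Y₁` and lifts `X₂`, `Y₂`,
  with map obstruction `θ_f ∈ H¹(X₁, f^*T_{Y₁})`: `o(f^*G; X₂) = f^*o(G; Y₂) + θ_f ⌟ f^*At(G)` and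
  `q_{X₂}(f^*c) = f^*q_{Y₂}(c) − ι(θ_f ⌟ f^*c̄^{(r,r)})` (the same first-order computations, `p² = 0`, NO
  divided powers) — give `Δ_X(f^*G) = f^*Δ_Y(G)`; Leibniz on both sides gives
  `Δ_•(E ⊗ L) = Δ_•(E) · e^{c̄₁(L)}` (rank one = Berthelot–Ogus, so `Δ_•(L) = 0`); and `Δ_{Grass}(𝒬) = 0`
  by (BI). Hence on smooth PROJECTIVE `X₁`: `Δ_r(E) = Δ_r(E(m)) · (unit) = f_m^* Δ_{Grass}(𝒬) · (unit) = 0`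
  — (β₁) in general, the cards' classifying-map proof (§7 audit) at the level where it is LINEAR.
WHAT THIS SEAT CONCLUDES: there is no first-step attack left; a counterexample to (β₁) must violate one of
two rules that are theorems of the 1970s. The deep steps (β_n), `n ≥ 2`, add only the divided-power window
(§7, proved) to the same two rules. -/

section ThickeningEquivariance

variable {K E Q : Type*} [AddCommGroup K] [AddCommGroup E] [AddCommGroup Q]

/-- **The defect `Δ = q + S o` of (β₁) is independent of the `W₂`-lift** (`o ↦ o + Aκ`, `q ↦ q − Bκ`,
`S ∘ A = B`). [folklore] -/
theorem padicBloch_defect_shift_invariant (A : K →+ E) (B : K →+ Q) (S : E →+ Q)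
    (hSA : S.comp A = B) (q : Q) (o : E) (κ : K) :
    (q - B κ) + S (o + A κ) = q + S o := by
  have h : S (A κ) = B κ := by rw [← AddMonoidHom.comp_apply, hSA]
  rw [map_add, h]
  abel

/-- **(β₁) at `X₂` ⟺ (β₁) at `X₂ + κ`** (sign `ε = −1`). [folklore] -/
theorem padicBloch_shift_iff (A : K →+ E) (B : K →+ Q) (S : E →+ Q) (hSA : S.comp A = B)
    (q : Q) (o : E) (κ : K) :
    q - B κ = -S (o + A κ) ↔ q = -S o := by
  have h : S (A κ) = B κ := by rw [← AddMonoidHom.comp_apply, hSA]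
  rw [map_add, h, neg_add', sub_left_inj]

/-- **(β₁) holds for every `E₁` liftable to SOME `W₂`-lift of `X₁`** (`o + Aκ = 0` there, and
`q − Bκ = 0` there by (BI)). In particular for the Dwork–Ogus bundle of §11.2, which lifts to `Ĵ(𝒞₂)`.
[folklore] -/
theorem padicBloch_of_liftsSomewhere (A : K →+ E) (B : K →+ Q) (S : E →+ Q) (hSA : S.comp A = B)
    (q : Q) (o : E) (κ : K) (hlift : o + A κ = 0) (hHodge : q - B κ = 0) : q = -S o := by
  rw [← padicBloch_shift_iff A B S hSA q o κ, hlift, hHodge, map_zero, neg_zero]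

/-- **The sign is forced**: "`q = +S o` at every lift" contradicts the rules (model `ℤ`, all maps `id`,
`q = o = 0`, `κ = 1`). [folklore] -/
theorem padicBloch_plus_sign_refuted :
    ¬ ∀ (K E Q : Type) [AddCommGroup K] [AddCommGroup E] [AddCommGroup Q] (A : K →+ E) (B : K →+ Q)
        (S : E →+ Q), S.comp A = B → ∀ (q : Q) (o : E) (κ : K), q = S o → q - B κ = S (o + A κ) := by
  intro h
  have h1 := h ℤ ℤ ℤ (AddMonoidHom.id ℤ) (AddMonoidHom.id ℤ) (AddMonoidHom.id ℤ) rfl 0 0 1 rfl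
  simp at h1

/-- **`Δ_r` is a class function on `K₀(X₁)/K₀^{lift}(X₁)`.** [folklore] -/
theorem defect_eq_of_sub_mem {G : Type*} [AddCommGroup G] (Δ : G →+ Q) (L : AddSubgroup G)
    (hL : ∀ z ∈ L, Δ z = 0) {x y : G} (hxy : x - y ∈ L) : Δ x = Δ y := by
  have h := hL _ hxy
  rwa [map_sub, sub_eq_zero] at h

end ThickeningEquivariance

/-! ### §11.2  The Dwork–Ogus witness (Finding 14): Hodge at all levels, `H_tf`, no lift — and not
semiregular, by the mechanism's own count

SOURCE (read 2026-08-16 from `numdam.org/article/CM_1986__58_1_111_0.pdf`): B. Dwork, A. Ogus, *Canonical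
liftings of Jacobians*, Compositio Math. 58 (1986) 111–131. Thm. (1.9), p. 117: "The set `Σ_{W₂}` of
pre-`W₂`-canonical curves in `M_g^{ord}(k)` is constructible. Its intersection with the nonhyperelliptic locus
is closed. If `g ≥ 4`, it is nowhere dense." (Def. (1.7): `X` is pre-`R`-canonical iff some smooth `Y/R` has
`J(Y) ≅ J^can(X)/R` as principally polarised abelian schemes; Prop. (2.2): pre-`W_n`-canonical ⟺ some lift of
`X` to `W_n` has Jacobian `J^can/W_n`.) §1, p. 113–115: (1.1.3) `H¹_cris(A/W) = U ⊕ T`, `F^*` bijective on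
`U`, `p`·(bijective) on `T`; p. 114: `T = Fil_can` lifts `F¹_Hodge`; (1.4.3) the canonical lift is the one
whose `Fil¹` is `F^*`-stable; p. 115: `(A^∨)^can = (A^can)^∨`, every polarisation lifts uniquely, `A^can` is
algebraizable (`p` odd). Independent explicit examples: Oort–Sekiguchi, J. Math. Soc. Japan 38 (1986)
427–437 (doi:10.2969/jmsj/03830427, read): Thm. (2.4) — for the ordinary non-hyperelliptic Artin–Schreier-type
curves `C₀` of genus `(p−1)(r−1)`, `r ≥ 3`, `p ≥ 5`, with an automorphism of order `p`, the generic fibre of the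
canonical lifting of `Jac(C₀)` is not a Jacobian; Cor. (2.5) — the same for a generic curve of genus
`g ≥ 2(p−1)`. NOTE: these explicit genera have `g ≥ 2(p−1) > p − 6`, OUTSIDE the crux's `d + 6 < p`; the
witness below therefore uses Dwork–Ogus' generic genus-4 statement (which is also the mod-`p²` one that `X₂`
needs), with any `p ≥ 11`.

THE WITNESS `(𝒳, E₁)` and its properties (a)–(d) are spelled out in Finding 14 of the module docstring. Two
checks recorded here. RANK OF THE CLAIM "all `φ`-Tate classes are Hodge on `A^can`": `x = Σ_b x_b`,
`x_b ∈ Λ^{2r−b}U ⊗ Λ^bT`, `φ x_b = p^b φ_b(x_b)` with `φ_b` `σ`-semilinear bijective; `φ x = p^r x` forces,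
for `b < r`, `x_b = p^{r−b} φ_b^{-1}(x_b) ∈ p^{r−b}M` and iterating `x_b ∈ ∩_N p^N M = 0`; for `b > r`,
`p^{b−r}φ_b(x_b) = x_b` and the same iteration; so `x = x_r ∈ Λ^rU ⊗ Λ^rT`, which has `r` factors in
`T = F¹H¹_dR(A^can/W)`, hence lies in `F^r` of `Λ^{2r}H¹_dR = H^{2r}_dR(A^can/W)`. CHERN CLASSES ARE
`φ`-TATE: `c_i^cris(Fr_X^* G) = Fr_X^* c_i^cris(G) = φ(c_i^cris G)` and, on the flag bundle of `G` (where
`π^*` is injective and `Fr^*` raises each line-bundle quotient to the `p`-th power),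
`c_i(Fr^*G) = p^i c_i(G)`.

THE COUNT (c): for `C` non-hyperelliptic of genus `g ≥ 3`, the Euler sequence `0 → T_C → 𝒪_C ⊗ T₀J → N_{C/J} → 0`
and Noether (`H¹(T_C) = H⁰(K²)^∨ ↪ (H⁰(K)^{⊗2})^∨ = H¹(𝒪)⊗T₀J`) give `h⁰(N) = g`, `h¹(N) = g² − (3g − 3)`;
Bloch's receptacle for the codimension-`(g−1)` cycle `C` is `H^g(J, Ω^{g−2}_J) = Λ^{g−2}T₀^∨ ⊗ Λ^gH¹(𝒪)`,
of dimension `g(g−1)/2`. `abelJacobi_semiregular_dimcount_iff`: injectivity of `π_C` is dimensionally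
possible iff `g ≤ 3`. So the p-adic semiregularity mechanism and Dwork–Ogus' theorem have the SAME
threshold, and on the semiregular side (`g = 3`, non-hyperelliptic, count tight) the mechanism's prediction
"`C` lifts into `J^can ⊗ W_n` for all `n`" is Dwork–Ogus' remark p. 117–118 (`Def(C) → Def(J,λ)` a closed
immersion of 6-dimensional formally smooth formal schemes, hence an isomorphism). -/

section DworkOgus

/-- **Bloch-semiregularity of the Abel–Jacobi curve is dimensionally possible iff `g ≤ 3`**:
`h¹(N_{C/J}) = g² − 3g + 3 ≤ g(g−1)/2 = h^g(J, Ω^{g−2})` iff `(g−2)(g−3) ≤ 0`. [folklore] -/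
theorem abelJacobi_semiregular_dimcount_iff (g : ℤ) (hg : 2 ≤ g) :
    2 * (g ^ 2 - 3 * g + 3) ≤ g * (g - 1) ↔ g ≤ 3 := by
  constructor
  · intro h
    by_contra h4
    push Not at h4
    nlinarith
  · intro h3
    interval_cases g <;> norm_num

/-- The genus-4 instance behind the witness: `7 > 6`. [folklore] -/
theorem abelJacobi_genus_four_count : (4 : ℤ) ^ 2 - 3 * 4 + 3 = 7 ∧ (4 : ℤ) * (4 - 1) / 2 = 6 := by
  norm_num

/-- **Record (no Lean content): what the witness does to each statement of the route.**
P1b (ii′)/(⋆): untouched (non-semiregular `E₁`; (⋆) in fact FAILS for `E_D`, a certified instance of §3 S2,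
given the P1a line's S1–S3). P1b (β₁): VERIFIED on `(Ĵ^can_2, E_D)` twice — by §11.1 (lifts to `Ĵ(𝒞₂)`)
and directly (Finding 14 (e): `σ_q(o(E_D)) = 0 ∀q` by the Fourier–Mukai dictionary, `At(E_D)² = 0`,
`ch(E_D) = rk − θ̂`, filtration count `F²Ext⁴_J(𝒪_C(D), 𝒪_C(D)) = 0`). P1a: consistent (its hypothesis (⋆)
fails for `E_D`). Repaired P1 minus semiregularity (S6): REFUTED. P2a: on ordinary-abelian-type models
"Hodge" is far from "liftable" for non-semiregular objects, so seeds MUST be semiregular — no shortcut through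
arbitrary sheaves with the right Chern character; and FM transforms of curve-supported sheaves are never
semiregular beyond the determinant (`σ_{≥1} ∘ o` factors through `F²`-products), so they are useless as seeds
in `d ≥ 3`.

DICTIONARY USED IN (e) (Mukai 1981 §3: `Φ` exchanges `t_x^*` and `⊗ P_x`; over `W₂` by `P^can`, commuting
with restriction by flat derived base change): `κ_v := v ⌟ At_Ĵ(E_D)` (`v ∈ H⁰(T_Ĵ) = T₀Ĵ = H¹(J,𝒪)`) is the
Kodaira–Spencer class of `t_{εv}^* E_D`, which is `Φ(F ⊗ P_{εv})`, whose class is `α(v) := i_*(v|_C)`,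
`i_* : H^*(C,𝒪) = Ext^*_C(F,F) → Ext^*_J(i_*F, i_*F)` an algebra map with `H²(C,𝒪) = 0`; `a · id_{E_D}`
(`a ∈ H¹(Ĵ,𝒪) = T₀J`) is the class of `E_D ⊗ P̂_{εa} = Φ(t_{εa}^*(i_*F))`, i.e. `τ_a := a ⌟ At_J(i_*F)`;
obstruction classes correspond under the `W₂`-linear equivalence; `Ext⁴_J(i_*F, i_*F) ≅ End(i_*F)^∨ = k`, so
no trace normalisation enters — the products themselves vanish. [folklore] -/
theorem dworkOgus_witness_recorded : True := trivial

end DworkOgus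

/-! ### §11.3  Characteristic-zero transfer (Finding 15) -/

section Transfer

variable {R : Type*} [CommRing R] {M N : Type*} [AddCommGroup M] [AddCommGroup N] [Module R M]
  [Module R N]

/-- **Injective mod `p` ⇒ injective** (source `p`-adically separated, target `p`-torsion-free). With
`M = Ext²_{𝒳'/W}(ℰ,ℰ)`, `N = ⊕_q H^{q+2}(𝒳', Ω^q)`, `f = ⊕σ_q` for a `W`-model `(𝒳', ℰ)` of `(X₁, E₁)`:
p-adic semiregularity of `E₁` (through `M/pM ↪ Ext²_{X₁}(E₁,E₁)`, base change for `Ext`) ⇒ `f` injective ⇒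
`ℰ_K` semiregular in characteristic `0`, where "semiregular ⇒ the Hodge locus of `ch` is the deformation
locus" is the Bloch–Buchweitz–Flenner–Pridham theorem. [folklore] -/
theorem injective_of_injective_mod (p : R) (f : M →ₗ[R] N)
    (hsep : ∀ m : M, (∀ n : ℕ, ∃ m' : M, m = p ^ n • m') → m = 0)
    (htf : ∀ x : N, p • x = 0 → x = 0)
    (hmod : ∀ m : M, (∃ x : N, f m = p • x) → ∃ m' : M, m = p • m') :
    Function.Injective f := by
  rw [injective_iff_map_eq_zero]
  intro m hm
  apply hsep
  intro n
  induction n generalizing m with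
  | zero => exact ⟨m, by rw [pow_zero, one_smul]⟩
  | succ n ih =>
    obtain ⟨m', rfl⟩ := hmod m ⟨0, by rw [hm, smul_zero]⟩
    have hm' : f m' = 0 := htf _ (by rw [← map_smul]; exact hm)
    obtain ⟨m'', hm''⟩ := ih m' hm'
    exact ⟨m'', by rw [hm'', smul_smul, ← pow_succ']⟩

/-- `p`-torsion-freeness of the target is load-bearing (`ℤ → ℤ/2` is "injective mod 2" on the separated
source but not injective): in the application, torsion in `H^{q+2}(𝒳', Ω^q)` — `H_tf` once more. [folklore] -/
theorem not_injective_of_injective_mod_without_torsionFree :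
    ¬ Function.Injective (Int.castAddHom (ZMod 2)) := by
  intro h
  have h2 : Int.castAddHom (ZMod 2) 2 = Int.castAddHom (ZMod 2) 0 := by decide
  exact absurd (h h2) (by decide)

end Transfer


end Summit.HodgeConjecture.HodgeConjecture.Cruxes.PadicPridhamSemiregularity.Disproof
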